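import Literature.Analysis.FluidPDE.NSSerrinEstimates
import HarnessLib

/-!
# Serrin's cross identity and the difference energy inequality; weak–strong uniqueness

Analysis/FluidPDE file completing the discharge programme of the Serrin–Prodi weak–strong
uniqueness theorem (`Literature.Analysis.FluidPDE.weak_strong_uniqueness`; Prodi 1959; Serrin 1963, Thm. 6;
Robinson–Rodrigo–Sadowski 2016, Thm. 8.19).

**On the statement.** The sources assume the initial datum `u₀ ∈ H = L²_σ` throughout
(RRS 2016, Def. 3.3 and Def. 4.9; Serrin 1963, §1; Galdi 2000, Def. 2.1), while the accepted
`Fluid.IsLerayHopfOn` records `u₀` only through Bochner pairings `∫ ⟪u₀, ·⟫`, the (junk-valued for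
`u₀ ∉ L²`) `kineticEnergy u₀`, and the lower-integral statement `eLpNorm (u t - u₀) 2 → 0`, and
the accepted named fact `NS.weak_strong_uniqueness` quantifies over *all* `u₀ : ℝ³ → ℝ³`. The
printed proof uses `u₀` as an `L²` test field (`⟨u(t), v(t)⟩ → ‖u₀‖²` as `t → 0⁺`), which is not
available for non-measurable data; we therefore vendor the source's statement with its standing
hypothesis `u₀ ∈ L²` under the new name `NS.serrin_weak_strong_uniqueness` (same cites) and
**prove** it (`NS.serrin_weak_strong_uniqueness_holds`), together with the corresponding form of
the difference energy inequality (`NS.serrin_difference_energy_ineq_memLp`, RRS (8.12), proved as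
`NS.serrin_difference_energy_ineq_memLp_holds`).

**Proof** (Serrin 1963, §4; RRS 2016, Lemma 8.18 and proof of Thm. 8.19; Sohr 2001, Thm. V.1.4.1).
Replace the weak-gradient witnesses by jointly measurable versions
(`Fluid.exists_stronglyMeasurable_weakGradient`). For a.e. `σ` the slice `v(σ)` is an admissible
`H¹_σ` test field for `u` and vice versa (`Fluid.IsLerayHopfOn.inner_weakGrad_test_eq`), giving the
two one-sided representations of `Q(s,σ) = ⟨u(s), v(σ)⟩` required by the abstract doubling lemma
(`Literature.Analysis.FunctionSpaces.doubling_identity`). The bulk limits are: the gradient terms and the trilinear term tested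
with the Serrin-class solution `u` truncated at height `M` (`Literature.Analysis.FunctionSpaces.tendsto_integral_normed_mul_integral_inner`),
the other trilinear term after the skew-symmetry `b(v,u,v) = -b(v,v,u)` at fixed times
(`Fluid.integral_inner_weakGrad_apply_add_eq_zero`) and truncation
(`Literature.Analysis.FunctionSpaces.tendsto_integral_normed_mul_integral_inner_of_bound`), the truncation remainders being small
uniformly in the mollification by the weighted Hölder inequality
(`Literature.Analysis.FunctionSpaces.lintegral_lintegral_normed_mul_mul_le`) and the Serrin condition. The resulting cross identity
`⟨u(t),v(t)⟩ + 2ν∫₀ᵗ⟨∇u,∇v⟩ = ‖u₀‖² - ∫₀ᵗ b(w,w,u)` (RRS, proof of Thm. 6.10, third display, and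
Lemma 8.18) is added to the two energy inequalities, which yields RRS (8.12); the final Gronwall
argument is the accepted reduction `NS.weak_strong_uniqueness_of`, repeated verbatim with the extra
hypothesis threaded through.

## References

* J. Serrin, *The initial value problem for the Navier–Stokes equations*, in: Nonlinear Problems
  (Madison 1962), Univ. Wisconsin Press 1963, §4 and Thm. 6 (`Serrin1963`).
* G. Prodi, *Un teorema di unicità per le equazioni di Navier–Stokes*, Ann. Mat. Pura Appl. 48
  (1959), 173–182 (`Prodi1959`).
* J. C. Robinson, J. L. Rodrigo, W. Sadowski, *The Three-Dimensional Navier–Stokes Equations*,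
  CUP 2016, Def. 3.3, Thm. 6.10, Lemma 8.18, (8.12), Thm. 8.19 (`RobinsonRodrigoSadowski2016`).
* G. P. Galdi, *An introduction to the Navier–Stokes initial–boundary value problem*, Birkhäuser
  2000, Def. 2.1, Thm. 4.2 (`Galdi2000`).
-/

noncomputable section

open MeasureTheory TopologicalSpace Set Function Filter Topology ContinuousLinearMap Module
open scoped ENNReal NNReal Convolution InnerProductSpace RealInnerProductSpace

namespace Literature.Analysis.FluidPDE

variable {E : Type*} [NormedAddCommGroup E] [InnerProductSpace ℝ E] [FiniteDimensional ℝ E]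
  [MeasurableSpace E] [BorelSpace E]

/-! ### Integrability of mollified pairings on the time square -/

section SquarePairing

/-- A kernel-weighted `L²`–`L²` pairing is integrable on the time square:
`(σ,s) ↦ ρ(s-σ) ∫⟪Φ(s), A(σ)⟫` with `A, Φ ∈ L²((0,t) × E)` (Cauchy–Schwarz in space, product of
integrable slice norms in time). [folklore] -/
theorem integrable_sq_normed_mul_integral_inner (φ : ContDiffBump (0 : ℝ)) {t : ℝ}
    {A Φ : ℝ → E → E} (hA : StronglyMeasurable (uncurry A)) (hΦ : StronglyMeasurable (uncurry Φ))
    (hA2 : eLpNorm (uncurry A) 2 ((volume.restrict (Ioo 0 t)).prod (volume : Measure E)) < ⊤)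
    (hΦ2 : eLpNorm (uncurry Φ) 2 ((volume.restrict (Ioo 0 t)).prod (volume : Measure E)) < ⊤) :
    Integrable (fun p : ℝ × ℝ => φ.normed volume (p.2 - p.1) * ∫ x, ⟪Φ p.2 x, A p.1 x⟫)
      ((volume.restrict (Ioo 0 t)).prod (volume.restrict (Ioo 0 t))) := by
  obtain ⟨C, hC0, hC⟩ := FunctionSpaces.exists_normed_le φ
  haveI : IsFiniteMeasure (volume.restrict (Ioo (0 : ℝ) t)) := by infer_instance
  set a : ℝ → ℝ≥0∞ := fun σ => eLpNorm (A σ) 2 volume with ha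
  set b : ℝ → ℝ≥0∞ := fun s => eLpNorm (Φ s) 2 volume with hb
  have hai : Integrable (fun σ => (a σ).toReal) (volume.restrict (Ioo 0 t)) :=
    FunctionSpaces.integrable_toReal_eLpNorm_slice hA hA2
  have hbi : Integrable (fun s => (b s).toReal) (volume.restrict (Ioo 0 t)) :=
    FunctionSpaces.integrable_toReal_eLpNorm_slice hΦ hΦ2
  have ha_fin : ∀ᵐ σ ∂(volume.restrict (Ioo 0 t)), a σ < ⊤ := FunctionSpaces.ae_eLpNorm_slice_lt_top hA hA2
  have hb_fin : ∀ᵐ s ∂(volume.restrict (Ioo 0 t)), b s < ⊤ := FunctionSpaces.ae_eLpNorm_slice_lt_top hΦ hΦ2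
  have hIm : StronglyMeasurable fun p : ℝ × ℝ => ∫ x, ⟪Φ p.2 x, A p.1 x⟫ := by
    have h : StronglyMeasurable fun q : (ℝ × ℝ) × E => ⟪Φ q.1.2 q.2, A q.1.1 q.2⟫ :=
      (hΦ.comp_measurable (measurable_fst.snd.prodMk measurable_snd)).inner (𝕜 := ℝ)
        (hA.comp_measurable (measurable_fst.fst.prodMk measurable_snd))
    exact h.integral_prod_right'
  have hm : AEStronglyMeasurable
      (fun p : ℝ × ℝ => φ.normed volume (p.2 - p.1) * ∫ x, ⟪Φ p.2 x, A p.1 x⟫)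
      ((volume.restrict (Ioo 0 t)).prod (volume.restrict (Ioo 0 t))) :=
    ((φ.continuous_normed.comp (continuous_snd.sub continuous_fst)).aestronglyMeasurable).mul
      hIm.aestronglyMeasurable
  refine Integrable.mono' ((hai.mul_prod hbi).const_mul C) hm ?_
  have h1 : ∀ᵐ p ∂((volume.restrict (Ioo 0 t)).prod (volume.restrict (Ioo 0 t))), a p.1 < ⊤ :=
    (Measure.quasiMeasurePreserving_fst (μ := volume.restrict (Ioo 0 t))
      (ν := volume.restrict (Ioo 0 t))).ae ha_fin
  have h2 : ∀ᵐ p ∂((volume.restrict (Ioo 0 t)).prod (volume.restrict (Ioo 0 t))), b p.2 < ⊤ :=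
    (Measure.quasiMeasurePreserving_snd (μ := volume.restrict (Ioo 0 t))
      (ν := volume.restrict (Ioo 0 t))).ae hb_fin
  filter_upwards [h1, h2] with p hp1 hp2
  rw [norm_mul, Real.norm_eq_abs, abs_of_nonneg (φ.nonneg_normed _)]
  have hI : ‖∫ x, ⟪Φ p.2 x, A p.1 x⟫‖ ≤ (b p.2).toReal * (a p.1).toReal := by
    rw [← toReal_enorm, ← ENNReal.toReal_mul]
    exact ENNReal.toReal_mono (ENNReal.mul_ne_top hp2.ne hp1.ne)
      (FunctionSpaces.enorm_integral_inner_le_eLpNorm_mul (hΦ.of_uncurry_left (x := p.2)).aestronglyMeasurable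
        (hA.of_uncurry_left (x := p.1)).aestronglyMeasurable)
  calc φ.normed volume (p.2 - p.1) * ‖∫ x, ⟪Φ p.2 x, A p.1 x⟫‖
      ≤ C * ((b p.2).toReal * (a p.1).toReal) := mul_le_mul (hC _) hI (norm_nonneg _) hC0
    _ = C * ((a p.1).toReal * (b p.2).toReal) := by ring

/-- A kernel-weighted `L¹`–`L^∞` pairing is integrable on the time square:
`(σ,s) ↦ ρ(s-σ) ∫⟪Φ(s), A(σ)⟫` with `A ∈ L¹((0,t) × E)` and `|Φ| ≤ C`. [folklore] -/
theorem integrable_sq_normed_mul_integral_inner_of_bound (φ : ContDiffBump (0 : ℝ)) {t : ℝ}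
    {A Φ : ℝ → E → E} (hA : StronglyMeasurable (uncurry A)) (hΦ : StronglyMeasurable (uncurry Φ))
    (hA1 : Integrable (uncurry A) ((volume.restrict (Ioo 0 t)).prod (volume : Measure E)))
    {C : ℝ} (hΦC : ∀ s x, ‖Φ s x‖ ≤ C) :
    Integrable (fun p : ℝ × ℝ => φ.normed volume (p.2 - p.1) * ∫ x, ⟪Φ p.2 x, A p.1 x⟫)
      ((volume.restrict (Ioo 0 t)).prod (volume.restrict (Ioo 0 t))) := by
  obtain ⟨Cρ, hCρ0, hCρ⟩ := FunctionSpaces.exists_normed_le φ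
  haveI : IsFiniteMeasure (volume.restrict (Ioo (0 : ℝ) t)) := by infer_instance
  set C' : ℝ := max C 0 with hC'
  have hC'0 : 0 ≤ C' := le_max_right _ _
  have hΦC' : ∀ s x, ‖Φ s x‖ ≤ C' := fun s x => (hΦC s x).trans (le_max_left _ _)
  have hAσi : ∀ᵐ σ ∂(volume.restrict (Ioo 0 t)), Integrable (A σ) volume := hA1.prod_right_ae
  have ha1 : Integrable (fun σ => ∫ x, ‖A σ x‖) (volume.restrict (Ioo 0 t)) :=
    hA1.integral_norm_prod_left
  have hIm : StronglyMeasurable fun p : ℝ × ℝ => ∫ x, ⟪Φ p.2 x, A p.1 x⟫ := by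
    have h : StronglyMeasurable fun q : (ℝ × ℝ) × E => ⟪Φ q.1.2 q.2, A q.1.1 q.2⟫ :=
      (hΦ.comp_measurable (measurable_fst.snd.prodMk measurable_snd)).inner (𝕜 := ℝ)
        (hA.comp_measurable (measurable_fst.fst.prodMk measurable_snd))
    exact h.integral_prod_right'
  have hm : AEStronglyMeasurable
      (fun p : ℝ × ℝ => φ.normed volume (p.2 - p.1) * ∫ x, ⟪Φ p.2 x, A p.1 x⟫)
      ((volume.restrict (Ioo 0 t)).prod (volume.restrict (Ioo 0 t))) :=
    ((φ.continuous_normed.comp (continuous_snd.sub continuous_fst)).aestronglyMeasurable).mul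
      hIm.aestronglyMeasurable
  refine Integrable.mono' ((ha1.mul_prod (integrable_const (1 : ℝ))).const_mul (Cρ * C')) hm ?_
  have h1 : ∀ᵐ p ∂((volume.restrict (Ioo 0 t)).prod (volume.restrict (Ioo 0 t))),
      Integrable (A p.1) volume :=
    (Measure.quasiMeasurePreserving_fst (μ := volume.restrict (Ioo 0 t))
      (ν := volume.restrict (Ioo 0 t))).ae hAσi
  filter_upwards [h1] with p hp
  rw [norm_mul, Real.norm_eq_abs, abs_of_nonneg (φ.nonneg_normed _), mul_one]
  have hI : ‖∫ x, ⟪Φ p.2 x, A p.1 x⟫‖ ≤ C' * ∫ x, ‖A p.1 x‖ := by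
    rw [← integral_const_mul]
    refine norm_integral_le_of_norm_le (hp.norm.const_mul C') (ae_of_all _ fun x => ?_)
    exact (norm_inner_le_norm (𝕜 := ℝ) _ _).trans
      (mul_le_mul_of_nonneg_right (hΦC' _ _) (norm_nonneg _))
  calc φ.normed volume (p.2 - p.1) * ‖∫ x, ⟪Φ p.2 x, A p.1 x⟫‖
      ≤ Cρ * (C' * ∫ x, ‖A p.1 x‖) := mul_le_mul (hCρ _) hI (norm_nonneg _) hCρ0
    _ = Cρ * C' * ∫ x, ‖A p.1 x‖ := by ring

end SquarePairing

/-! ### The data of the cross-identity argument -/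

section Data

variable (E) in
/-- **Bookkeeping bundle for Serrin's cross-identity argument** (no mathematical content; it
packages the standing hypotheses of RRS 2016, Lemma 8.18 / Thm. 8.19 once): two Leray–Hopf
solutions `u, v` of the unforced system on `E × [0,T)`, `dim E = 3`, with common datum
`u₀ ∈ L²`, `u` in the Serrin class `L^q(0,T;L^r)`, `2/q + 3/r ≤ 1`, `3 < r`, jointly measurable
weak-gradient witnesses `Gu, Gv` of finite dissipation, and jointly measurable versions `ũ, ṽ`
of `u, v`. [folklore] -/
structure CrossData (T ν : ℝ) (u₀ : E → E) (u v : ℝ → E → E) (q r : ℝ≥0∞)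
    (Gu Gv : ℝ → E → E →L[ℝ] E) (ut vt : ℝ × E → E) : Prop where
  /-- dimension three -/
  hE3 : finrank ℝ E = 3
  /-- positive viscosity -/
  hν : 0 < ν
  /-- positive final time -/
  hT : 0 < T
  /-- `u` is a Leray–Hopf solution -/
  hu : IsLerayHopfOn T ν 0 u₀ u
  /-- `v` is a Leray–Hopf solution -/
  hv : IsLerayHopfOn T ν 0 u₀ v
  /-- the datum is in `L²` -/
  hu₀ : MemLp u₀ 2 volume
  /-- Serrin space exponent -/
  hr : 3 < r
  /-- Serrin condition -/
  hqr : 2 / q + 3 / r ≤ 1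
  /-- `u` is in the Serrin class -/
  hS : MemLqLp q r u (Ioo 0 T)
  /-- `Gu` is jointly measurable -/
  hGum : StronglyMeasurable (uncurry Gu)
  /-- `Gv` is jointly measurable -/
  hGvm : StronglyMeasurable (uncurry Gv)
  /-- `Gu t` is a weak gradient of `u t` for a.e. `t` -/
  hGu : ∀ᵐ t ∂(volume.restrict (Ioo 0 T)), HasWeakGradient (u t) (Gu t)
  /-- `Gv t` is a weak gradient of `v t` for a.e. `t` -/
  hGv : ∀ᵐ t ∂(volume.restrict (Ioo 0 T)), HasWeakGradient (v t) (Gv t)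
  /-- finite dissipation of `u` -/
  hGu₂ : ∫⁻ t in Ioo 0 T, ∫⁻ x, ENNReal.ofReal (frobeniusNormSq (Gu t x)) < ⊤
  /-- finite dissipation of `v` -/
  hGv₂ : ∫⁻ t in Ioo 0 T, ∫⁻ x, ENNReal.ofReal (frobeniusNormSq (Gv t x)) < ⊤
  /-- `ũ` is jointly measurable -/
  hutm : StronglyMeasurable ut
  /-- `ṽ` is jointly measurable -/
  hvtm : StronglyMeasurable vt
  /-- `ũ` is a version of `u` -/
  hut : uncurry u =ᵐ[(volume.restrict (Ioo 0 T)).prod (volume : Measure E)] ut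
  /-- `ṽ` is a version of `v` -/
  hvt : uncurry v =ᵐ[(volume.restrict (Ioo 0 T)).prod (volume : Measure E)] vt
  /-- energy inequality of `u` from `0`, for the witness `Gu` -/
  hEu : ∀ t ∈ Icc 0 T, VectorCalculus.kineticEnergy (u t) +
    ν * (∫⁻ τ in Ioo 0 t, ∫⁻ x, ENNReal.ofReal (frobeniusNormSq (Gu τ x))).toReal ≤ VectorCalculus.kineticEnergy u₀
  /-- energy inequality of `v` from `0`, for the witness `Gv` -/
  hEv : ∀ t ∈ Icc 0 T, VectorCalculus.kineticEnergy (v t) +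
    ν * (∫⁻ τ in Ioo 0 t, ∫⁻ x, ENNReal.ofReal (frobeniusNormSq (Gv τ x))).toReal ≤ VectorCalculus.kineticEnergy u₀

end Data

/-! ### The bulk limits -/

section Bulk

variable {T ν : ℝ} {u₀ : E → E} {u v : ℝ → E → E} {q r : ℝ≥0∞} {Gu Gv : ℝ → E → E →L[ℝ] E}
  {ut vt : ℝ × E → E}

/-- Restricting a finite dissipation to `(0, t) ⊆ (0, T)`. [folklore] -/
theorem lintegral_Ioo_mono_lt_top {t : ℝ} (ht : t ≤ T) {D : ℝ → ℝ≥0∞}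
    (hD : ∫⁻ s in Ioo 0 T, D s < ⊤) : ∫⁻ s in Ioo 0 t, D s < ⊤ :=
  lt_of_le_of_lt (lintegral_mono_set (Ioo_subset_Ioo le_rfl ht)) hD

/-- Restricting an a.e. statement from `(0, T)` to `(0, t)`. [folklore] -/
theorem ae_restrict_Ioo_of_le {t : ℝ} (ht : t ≤ T) {P : ℝ → Prop}
    (h : ∀ᵐ s ∂(volume.restrict (Ioo 0 T)), P s) : ∀ᵐ s ∂(volume.restrict (Ioo 0 t)), P s :=
  ae_restrict_of_ae_restrict_of_subset (Ioo_subset_Ioo le_rfl ht) h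

/-- Restricting a version statement from `(0, T)` to `(0, t)`. [folklore] -/
theorem version_restrict {t : ℝ} (ht : t ≤ T) {w : ℝ → E → E} {wt : ℝ × E → E}
    (h : uncurry w =ᵐ[(volume.restrict (Ioo 0 T)).prod (volume : Measure E)] wt) :
    uncurry w =ᵐ[(volume.restrict (Ioo 0 t)).prod (volume : Measure E)] wt := by
  have hle : (volume.restrict (Ioo (0 : ℝ) t)).prod (volume : Measure E) ≤
      (volume.restrict (Ioo 0 T)).prod (volume : Measure E) :=
    Measure.prod_mono (Measure.restrict_mono (Ioo_subset_Ioo le_rfl ht) le_rfl) le_rfl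
  exact h.filter_mono (ae_mono hle)

/-- **The gradient bulk limit.** `∫∫ ρₙ(s-σ) Σᵢ⟨Gu(s)eᵢ, Gv(σ)eᵢ⟩ dσ ds → ∫₀ᵗ Σᵢ ⟨Gu eᵢ, Gv eᵢ⟩ ds`
(the `L²`–`L²` pairing limit of `TimeMollification`, componentwise; Serrin 1963, §4, the term
`2ν∫⟨∇u, ∇v⟩` of the cross identity). [cite: Serrin1963, §4] -/
theorem CrossData.tendsto_grad (h : CrossData E T ν u₀ u v q r Gu Gv ut vt) {t : ℝ}
    (ht : t ∈ Ioc 0 T) {φ : ℕ → ContDiffBump (0 : ℝ)}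
    (hφ : Tendsto (fun n => (φ n).rOut) atTop (𝓝 0)) :
    Tendsto (fun n => ∫ p, (φ n).normed volume (p.2 - p.1) *
        (∑ i, ∫ x, ⟪Gu p.2 x (stdOrthonormalBasis ℝ E i), Gv p.1 x (stdOrthonormalBasis ℝ E i)⟫)
        ∂((volume.restrict (Ioo 0 t)).prod (volume.restrict (Ioo 0 t))))
      atTop (𝓝 (∫ s in Ioo 0 t, ∑ i, ∫ x,
        ⟪Gu s x (stdOrthonormalBasis ℝ E i), Gv s x (stdOrthonormalBasis ℝ E i)⟫)) := by
  set b := stdOrthonormalBasis ℝ E with hb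
  have hb1 : ∀ i, ‖b i‖ = 1 := fun i => b.orthonormal.1 i
  have hGu₂t := lintegral_Ioo_mono_lt_top ht.2 h.hGu₂
  have hGv₂t := lintegral_Ioo_mono_lt_top ht.2 h.hGv₂
  -- the components
  set Φ : Fin (finrank ℝ E) → ℝ → E → E := fun i s x => Gu s x (b i) with hΦ
  set A : Fin (finrank ℝ E) → ℝ → E → E := fun i σ x => Gv σ x (b i) with hA
  have hΦm : ∀ i, StronglyMeasurable (uncurry (Φ i)) := fun i =>
    (ContinuousLinearMap.apply ℝ E (b i)).continuous.comp_stronglyMeasurable h.hGum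
  have hAm : ∀ i, StronglyMeasurable (uncurry (A i)) := fun i =>
    (ContinuousLinearMap.apply ℝ E (b i)).continuous.comp_stronglyMeasurable h.hGvm
  have hΦ2 : ∀ i, eLpNorm (uncurry (Φ i)) 2 ((volume.restrict (Ioo 0 t)).prod (volume : Measure E)) < ⊤ :=
    fun i => eLpNorm_grad_apply_prod_lt_top h.hGum hGu₂t (b i) (hb1 i)
  have hA2 : ∀ i, eLpNorm (uncurry (A i)) 2 ((volume.restrict (Ioo 0 t)).prod (volume : Measure E)) < ⊤ :=
    fun i => eLpNorm_grad_apply_prod_lt_top h.hGvm hGv₂t (b i) (hb1 i)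
  -- componentwise limits
  have hlim : ∀ i, Tendsto (fun n => ∫ p, (φ n).normed volume (p.2 - p.1) *
      (∫ x, ⟪Φ i p.2 x, A i p.1 x⟫) ∂((volume.restrict (Ioo 0 t)).prod (volume.restrict (Ioo 0 t))))
      atTop (𝓝 (∫ z, ⟪Φ i z.1 z.2, A i z.1 z.2⟫ ∂((volume.restrict (Ioo 0 t)).prod (volume : Measure E)))) :=
    fun i => FunctionSpaces.tendsto_integral_normed_mul_integral_inner hφ (hAm i) (hΦm i) (hA2 i) (hΦ2 i)
  have hsum := tendsto_finsetSum Finset.univ fun i _ => hlim i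
  -- identify the left-hand sides
  have hL : ∀ n, (∫ p, (φ n).normed volume (p.2 - p.1) * (∑ i, ∫ x, ⟪Gu p.2 x (b i), Gv p.1 x (b i)⟫)
      ∂((volume.restrict (Ioo 0 t)).prod (volume.restrict (Ioo 0 t)))) =
      ∑ i, ∫ p, (φ n).normed volume (p.2 - p.1) * (∫ x, ⟪Φ i p.2 x, A i p.1 x⟫)
        ∂((volume.restrict (Ioo 0 t)).prod (volume.restrict (Ioo 0 t))) := by
    intro n
    rw [← integral_finsetSum _ fun i _ =>
      integrable_sq_normed_mul_integral_inner (φ n) (hAm i) (hΦm i) (hA2 i) (hΦ2 i)]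
    congr 1; ext p
    rw [Finset.mul_sum]
  -- identify the right-hand side
  have hint : ∀ i, Integrable (fun z : ℝ × E => ⟪Φ i z.1 z.2, A i z.1 z.2⟫)
      ((volume.restrict (Ioo 0 t)).prod (volume : Measure E)) := fun i =>
    FunctionSpaces.integrable_inner_of_eLpNorm_two_lt_top (hΦm i).aestronglyMeasurable
      (hAm i).aestronglyMeasurable (hΦ2 i) (hA2 i)
  have hR : (∑ i, ∫ z, ⟪Φ i z.1 z.2, A i z.1 z.2⟫ ∂((volume.restrict (Ioo 0 t)).prod (volume : Measure E))) =
      ∫ s in Ioo 0 t, ∑ i, ∫ x, ⟪Gu s x (b i), Gv s x (b i)⟫ := by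
    rw [integral_finsetSum _ fun i _ => (hint i).integral_prod_left]
    refine Finset.sum_congr rfl fun i _ => ?_
    rw [integral_prod _ (hint i)]
  rw [← hR]
  refine hsum.congr fun n => (hL n).symm

omit [MeasurableSpace E] [BorelSpace E] in
/-- Expansion of a trilinear density in the standard frame:
`⟪L y, w⟫ = Σᵢ ⟪⟪y, eᵢ⟫ w, L eᵢ⟫`. [folklore] -/
theorem inner_apply_eq_sum_frame (L : E →L[ℝ] E) (y w : E) :
    ⟪L y, w⟫ = ∑ i, ⟪⟪y, stdOrthonormalBasis ℝ E i⟫ • w, L (stdOrthonormalBasis ℝ E i)⟫ := by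
  set b := stdOrthonormalBasis ℝ E
  conv_lhs => rw [← b.sum_repr' y]
  rw [map_sum, sum_inner]
  refine Finset.sum_congr rfl fun i _ => ?_
  rw [map_smul, real_inner_smul_left, real_inner_smul_left, real_inner_comm (b i) y,
    real_inner_comm (L (b i)) w]

/-- **Finiteness of the A-side tail functional** (the Serrin condition): for every `M`,
`∫₀ᵀ (‖ũ(s)‖_p m_M(s))² ds ≤ C (∫‖∇u‖²)^θ (∫ m_M^{2/(1-θ)})^{1-θ} < ∞`. [folklore] -/
theorem CrossData.lintegral_conj_mul_tail_sq_lt_top (h : CrossData E T ν u₀ u v q r Gu Gv ut vt)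
    (M : ℝ) :
    ∫⁻ s in Ioo 0 T, (eLpNorm (fun x => ut (s, x)) ((2⁻¹ - r⁻¹)⁻¹) volume *
      eLpNorm ({x | M ≤ ‖ut (s, x)‖}.indicator fun x => ut (s, x)) r volume) ^ (2 : ℝ) < ⊤ := by
  obtain ⟨hθ0, hθ1, hρq⟩ := serrin_exponent_props h.hr h.hqr
  set θ : ℝ := ((3 : ℝ≥0∞) / r).toReal with hθ
  set q₀ : ℝ := 2 / (1 - θ) with hq₀
  have h1θ : 0 < 1 - θ := by linarith
  have hq₀0 : 0 < q₀ := div_pos two_pos h1θ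
  obtain ⟨K, hK⟩ := h.hu.energy_bound
  set Cs : ℝ≥0∞ := (SNormLESNormFDerivOfEqConst E (volume : Measure E) 2 : ℝ≥0∞) with hCs
  set C₁ : ℝ≥0∞ := ((K : ℝ≥0∞) ^ (1 / 2 : ℝ)) ^ (1 - θ) * Cs ^ θ with hC₁
  have hC₁top : C₁ ≠ ⊤ := ENNReal.mul_ne_top
    (ENNReal.rpow_ne_top_of_nonneg h1θ.le (ENNReal.rpow_ne_top_of_nonneg (by norm_num) ENNReal.coe_ne_top))
    (ENNReal.rpow_ne_top_of_nonneg hθ0 ENNReal.coe_ne_top)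
  set D : ℝ → ℝ≥0∞ := fun s => ∫⁻ x, ENNReal.ofReal (frobeniusNormSq (Gu s x)) with hD
  have hDm : Measurable D := measurable_lintegral_frobeniusNormSq h.hGum
  set m : ℝ → ℝ≥0∞ := fun s =>
    eLpNorm ({x | M ≤ ‖ut (s, x)‖}.indicator fun x => ut (s, x)) r volume with hm
  have hN : Measurable fun s => eLpNorm (fun x => ut (s, x)) r volume :=
    FunctionSpaces.measurable_eLpNorm_slice (g := fun s x => ut (s, x)) h.hutm r
  have hslice := ae_slice_eq_of_uncurry_ae_eq h.hut
  have hpt : ∀ᵐ s ∂(volume.restrict (Ioo 0 T)),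
      (eLpNorm (fun x => ut (s, x)) ((2⁻¹ - r⁻¹)⁻¹) volume * m s) ^ (2 : ℝ) ≤
        C₁ ^ (2 : ℝ) * (D s ^ θ * (eLpNorm (fun x => ut (s, x)) r volume ^ q₀) ^ (1 - θ)) := by
    filter_upwards [h.hu.ae_eLpNorm_conj_version_le h.hE3 h.hr h.hGu h.hut hK] with s hs
    have hmle : m s ≤ eLpNorm (fun x => ut (s, x)) r volume :=
      eLpNorm_mono fun x => norm_indicator_le_norm_self _ _
    have hm2 : eLpNorm (fun x => ut (s, x)) r volume ^ (2 : ℝ) =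
        (eLpNorm (fun x => ut (s, x)) r volume ^ q₀) ^ (1 - θ) := by
      rw [← ENNReal.rpow_mul, hq₀, div_mul_cancel₀ _ h1θ.ne']
    calc (eLpNorm (fun x => ut (s, x)) ((2⁻¹ - r⁻¹)⁻¹) volume * m s) ^ (2 : ℝ)
        ≤ (C₁ * D s ^ (θ / 2) * eLpNorm (fun x => ut (s, x)) r volume) ^ (2 : ℝ) := by
          gcongr ?_ ^ _
          exact mul_le_mul' hs hmle
      _ = C₁ ^ (2 : ℝ) * (D s ^ θ * (eLpNorm (fun x => ut (s, x)) r volume ^ q₀) ^ (1 - θ)) := by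
          rw [ENNReal.mul_rpow_of_nonneg _ _ zero_le_two, ENNReal.mul_rpow_of_nonneg _ _ zero_le_two,
            ← ENNReal.rpow_mul, show θ / 2 * 2 = θ by ring, hm2]
          ring
  have hfinr : ∫⁻ s in Ioo 0 T, eLpNorm (fun x => ut (s, x)) r volume ^ q₀ < ⊤ := by
    have hvol : volume (Ioo 0 T) ≠ ⊤ := by rw [Real.volume_Ioo]; exact ENNReal.ofReal_ne_top
    have h' := FluidPDE.lintegral_rpow_eLpNorm_lt_top hvol h.hS hq₀0.le hρq
    refine lt_of_le_of_lt (le_of_eq (lintegral_congr_ae ?_)) h'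
    filter_upwards [hslice] with s hs
    rw [eLpNorm_congr_ae hs]
  calc ∫⁻ s in Ioo 0 T, (eLpNorm (fun x => ut (s, x)) ((2⁻¹ - r⁻¹)⁻¹) volume * m s) ^ (2 : ℝ)
      ≤ ∫⁻ s in Ioo 0 T, C₁ ^ (2 : ℝ) * (D s ^ θ *
          (eLpNorm (fun x => ut (s, x)) r volume ^ q₀) ^ (1 - θ)) := lintegral_mono_ae hpt
    _ = C₁ ^ (2 : ℝ) * ∫⁻ s in Ioo 0 T, D s ^ θ *
          (eLpNorm (fun x => ut (s, x)) r volume ^ q₀) ^ (1 - θ) := by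
        rw [lintegral_const_mul' _ _ (ENNReal.rpow_ne_top_of_nonneg zero_le_two hC₁top)]
    _ ≤ C₁ ^ (2 : ℝ) * ((∫⁻ s in Ioo 0 T, D s) ^ θ *
          (∫⁻ s in Ioo 0 T, eLpNorm (fun x => ut (s, x)) r volume ^ q₀) ^ (1 - θ)) := by
        gcongr
        exact ENNReal.lintegral_mul_norm_pow_le hDm.aemeasurable
          ((hN.pow_const _)).aemeasurable hθ0 h1θ.le (by ring)
    _ < ⊤ := ENNReal.mul_lt_top (ENNReal.rpow_lt_top_of_nonneg zero_le_two hC₁top)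
          (ENNReal.mul_lt_top (ENNReal.rpow_lt_top_of_nonneg hθ0 h.hGu₂.ne)
            (ENNReal.rpow_lt_top_of_nonneg h1θ.le hfinr.ne))

omit [InnerProductSpace ℝ E] [FiniteDimensional ℝ E] [MeasurableSpace E] [BorelSpace E] in
/-- The part above height `0` is the whole field. [folklore] -/
theorem indicator_le_norm_zero (f : E → E) : {x | (0 : ℝ) ≤ ‖f x‖}.indicator f = f := by
  funext x
  exact indicator_of_mem (by simp) f

/-- **The A-side trilinear bulk limit** (Serrin 1963, §4; RRS 2016, proof of Lemma 8.18):
`∫∫ ρₙ(s-σ) ⟨(u(s)·∇)v(σ), u(s)⟩ dσ ds → ∫₀ᵗ ⟨(u·∇)v, u⟩ ds`, i.e. with densities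
`∫ ⟪Gv(σ) u(s), u(s)⟫`. Proof: truncate the second factor `u = u^{<M} + u^{≥M}`; the truncated
term is a finite sum of `L²`–`L²` pairings `⟨⟪ũ,eᵢ⟫ũ^{<M}, Gv eᵢ⟩` handled by
`tendsto_integral_normed_mul_integral_inner`, and the remainders are `≤ ‖∇v‖ (∫(‖ũ‖_p m_M)²)^{1/2}`
uniformly in `n` (`remainderA_le`, `remainderA_diag_le`), which is small for large `M` by the
Serrin condition (`tendsto_lintegral_conj_mul_tail_sq`). [cite: Serrin1963, §4] -/
theorem CrossData.tendsto_triA (h : CrossData E T ν u₀ u v q r Gu Gv ut vt) {t : ℝ}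
    (ht : t ∈ Ioc 0 T) {φ : ℕ → ContDiffBump (0 : ℝ)}
    (hφ : Tendsto (fun n => (φ n).rOut) atTop (𝓝 0)) :
    Tendsto (fun n => ∫ p, (φ n).normed volume (p.2 - p.1) *
        (∫ x, ⟪Gv p.1 x (u p.2 x), u p.2 x⟫) ∂((volume.restrict (Ioo 0 t)).prod (volume.restrict (Ioo 0 t))))
      atTop (𝓝 (∫ s in Ioo 0 t, ∫ x, ⟪Gv s x (u s x), u s x⟫)) := by
  classical
  set b := stdOrthonormalBasis ℝ E with hb
  have hb1 : ∀ i, ‖b i‖ = 1 := fun i => b.orthonormal.1 i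
  haveI : ENNReal.HolderTriple 4 4 2 := holderTriple_four_four_two
  set νt : Measure ℝ := volume.restrict (Ioo 0 t) with hνt
  haveI : IsFiniteMeasure νt := by rw [hνt]; infer_instance
  have hGv₂t : ∫⁻ s in Ioo 0 t, ∫⁻ x, ENNReal.ofReal (frobeniusNormSq (Gv s x)) < ⊤ :=
    lintegral_Ioo_mono_lt_top ht.2 h.hGv₂
  have hut2 : eLpNorm ut 2 (νt.prod (volume : Measure E)) < ⊤ := by
    refine lt_of_le_of_lt (eLpNorm_mono_measure _ (Measure.prod_mono
      (Measure.restrict_mono (Ioo_subset_Ioo le_rfl ht.2) le_rfl) le_rfl)) ?_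
    exact h.hu.eLpNorm_two_version_lt_top h.hutm h.hut
  -- ### the objects
  obtain ⟨Tt, hTt⟩ : ∃ F : ℝ × ℝ → ℝ,
      F = fun p => ∫ x, ⟪Gv p.1 x (ut (p.2, x)), ut (p.2, x)⟫ := ⟨_, rfl⟩
  obtain ⟨RM, hRM⟩ : ∃ F : ℕ → ℝ × ℝ → ℝ, F = fun (M : ℕ) (p : ℝ × ℝ) =>
      ∫ x, ⟪Gv p.1 x (ut (p.2, x)),
        {y | (M : ℝ) ≤ ‖ut (p.2, y)‖}.indicator (fun y => ut (p.2, y)) x⟫ := ⟨_, rfl⟩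
  obtain ⟨TM, hTM⟩ : ∃ F : ℕ → ℝ × ℝ → ℝ, F = fun (M : ℕ) (p : ℝ × ℝ) =>
      ∫ x, ⟪Gv p.1 x (ut (p.2, x)),
        {y | ‖ut (p.2, y)‖ < (M : ℝ)}.indicator (fun y => ut (p.2, y)) x⟫ := ⟨_, rfl⟩
  obtain ⟨ΦM, hΦM⟩ : ∃ F : ℕ → Fin (finrank ℝ E) → ℝ → E → E, F = fun (M : ℕ) i (s : ℝ) (x : E) =>
      ⟪ut (s, x), b i⟫ • {y | ‖ut (s, y)‖ < (M : ℝ)}.indicator (fun y => ut (s, y)) x := ⟨_, rfl⟩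
  obtain ⟨A, hA⟩ : ∃ F : Fin (finrank ℝ E) → ℝ → E → E, F = fun i σ x => Gv σ x (b i) := ⟨_, rfl⟩
  -- measurability and `L²` facts for `ΦM`, `A`
  have hΦMeq : ∀ M i, uncurry (ΦM M i) =
      fun p : ℝ × E => ⟪ut p, b i⟫ • {p | ‖ut p‖ < (M : ℝ)}.indicator ut p := by
    intro M i; funext p
    simp only [hΦM, uncurry, indicator_apply, mem_setOf_eq, Prod.mk.eta]
  have hΦMm : ∀ M i, StronglyMeasurable (uncurry (ΦM M i)) := fun M i => by
    rw [hΦMeq]; exact (memLp_two_inner_smul_truncation h.hutm hut2 (b i) (hb1 i) (Nat.cast_nonneg M)).1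
  have hΦM2 : ∀ M i, eLpNorm (uncurry (ΦM M i)) 2 (νt.prod (volume : Measure E)) < ⊤ := fun M i => by
    rw [hΦMeq]; exact (memLp_two_inner_smul_truncation h.hutm hut2 (b i) (hb1 i) (Nat.cast_nonneg M)).2
  have hAm : ∀ i, StronglyMeasurable (uncurry (A i)) := fun i => by
    rw [hA]; exact (ContinuousLinearMap.apply ℝ E (b i)).continuous.comp_stronglyMeasurable h.hGvm
  have hA2 : ∀ i, eLpNorm (uncurry (A i)) 2 (νt.prod (volume : Measure E)) < ⊤ := fun i => by
    rw [hA]; exact eLpNorm_grad_apply_prod_lt_top h.hGvm hGv₂t (b i) (hb1 i)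
  -- ### good times
  have hgu : ∀ᵐ s ∂νt, s ∈ Ioo 0 T ∧ MemLp (u s) 2 volume ∧ IsWeaklyDivFree (u s) ∧
      HasWeakGradient (u s) (Gu s) ∧ ∫⁻ x, ENNReal.ofReal (frobeniusNormSq (Gu s x)) < ⊤ ∧
      eLpNorm (u s) 4 volume < ⊤ ∧ u s =ᵐ[volume] fun x => ut (s, x) :=
    ae_restrict_Ioo_of_le ht.2 (h.hu.ae_good h.hE3 h.hGum h.hGu h.hGu₂ h.hut)
  have hgv : ∀ᵐ σ ∂νt, ∫⁻ x, ENNReal.ofReal (frobeniusNormSq (Gv σ x)) < ⊤ :=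
    ae_restrict_Ioo_of_le ht.2 (ae_lt_top (measurable_lintegral_frobeniusNormSq h.hGvm) h.hGv₂.ne)
  have hgp : ∀ᵐ p ∂(νt.prod νt),
      (∫⁻ x, ENNReal.ofReal (frobeniusNormSq (Gv p.1 x)) < ⊤) ∧
      (MemLp (u p.2) 2 volume ∧ eLpNorm (u p.2) 4 volume < ⊤ ∧ u p.2 =ᵐ[volume] fun x => ut (p.2, x)) := by
    filter_upwards [(Measure.quasiMeasurePreserving_fst (μ := νt) (ν := νt)).ae hgv,
      (Measure.quasiMeasurePreserving_snd (μ := νt) (ν := νt)).ae hgu] with p h1 h2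
    exact ⟨h1, h2.2.1, h2.2.2.2.2.2.1, h2.2.2.2.2.2.2⟩
  -- ### slice facts at good points
  have key : ∀ σ s, ∫⁻ x, ENNReal.ofReal (frobeniusNormSq (Gv σ x)) < ⊤ → MemLp (u s) 2 volume →
      eLpNorm (u s) 4 volume < ⊤ → (u s =ᵐ[volume] fun x => ut (s, x)) →
      (∫ x, ⟪Gv σ x (u s x), u s x⟫) = Tt (σ, s) ∧
      (∀ M : ℕ, Integrable (fun x => ⟪Gv σ x (ut (s, x)),
          {y | (M : ℝ) ≤ ‖ut (s, y)‖}.indicator (fun y => ut (s, y)) x⟫) volume) ∧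
      (∀ M : ℕ, Tt (σ, s) = TM M (σ, s) + RM M (σ, s)) ∧
      (∀ M : ℕ, (∀ i, Integrable (fun x => ⟪ΦM M i s x, A i σ x⟫) volume) ∧
        TM M (σ, s) = ∑ i, ∫ x, ⟪ΦM M i s x, A i σ x⟫) := by
    intro σ s hD h2 h4 hsl
    have hGσ : AEStronglyMeasurable (Gv σ) volume := (h.hGvm.of_uncurry_left (x := σ)).aestronglyMeasurable
    have hus : StronglyMeasurable fun x => ut (s, x) :=
      h.hutm.comp_measurable (measurable_const.prodMk measurable_id)
    have hmem4 : MemLp (fun x => ut (s, x)) 4 volume := MemLp.ae_eq hsl ⟨h2.1, h4⟩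
    have hmem2 : MemLp (fun x => ut (s, x)) 2 volume := h2.ae_eq hsl
    have hSlt : ∀ M : ℕ, MeasurableSet {y | ‖ut (s, y)‖ < (M : ℝ)} := fun M =>
      measurableSet_lt hus.norm.measurable measurable_const
    have hSge : ∀ M : ℕ, MeasurableSet {y | (M : ℝ) ≤ ‖ut (s, y)‖} := fun M =>
      measurableSet_le measurable_const hus.norm.measurable
    have hlt4 : ∀ M : ℕ, MemLp ({y | ‖ut (s, y)‖ < (M : ℝ)}.indicator fun y => ut (s, y)) 4 volume :=
      fun M => hmem4.indicator (hSlt M)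
    have hge4 : ∀ M : ℕ, MemLp ({y | (M : ℝ) ≤ ‖ut (s, y)‖}.indicator fun y => ut (s, y)) 4 volume :=
      fun M => hmem4.indicator (hSge M)
    have hlt2 : ∀ M : ℕ, MemLp ({y | ‖ut (s, y)‖ < (M : ℝ)}.indicator fun y => ut (s, y)) 2 volume :=
      fun M => hmem2.indicator (hSlt M)
    -- integrability of the three pairings
    have iT : Integrable (fun x => ⟪Gv σ x (ut (s, x)), ut (s, x)⟫) volume :=
      integrable_inner_apply_of_holder hGσ hD hmem4 hmem4
    have iM : ∀ M : ℕ, Integrable (fun x => ⟪Gv σ x (ut (s, x)),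
        {y | ‖ut (s, y)‖ < (M : ℝ)}.indicator (fun y => ut (s, y)) x⟫) volume := fun M =>
      integrable_inner_apply_of_holder hGσ hD hmem4 (hlt4 M)
    have iR : ∀ M : ℕ, Integrable (fun x => ⟪Gv σ x (ut (s, x)),
        {y | (M : ℝ) ≤ ‖ut (s, y)‖}.indicator (fun y => ut (s, y)) x⟫) volume := fun M =>
      integrable_inner_apply_of_holder hGσ hD hmem4 (hge4 M)
    refine ⟨?_, iR, fun M => ?_, fun M => ?_⟩
    · -- version
      simp only [hTt]
      refine integral_congr_ae ?_
      filter_upwards [hsl] with x hx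
      rw [hx]
    · -- splitting
      simp only [hTt, hTM, hRM]
      rw [← integral_add (iM M) (iR M)]
      refine integral_congr_ae (ae_of_all _ fun x => ?_)
      dsimp only
      rw [← inner_add_right]
      congr 1
      have := congrFun (indicator_norm_lt_add_indicator_le (fun y => ut (s, y)) (M : ℝ)) x
      simpa only [Pi.add_apply] using this.symm
    · -- frame expansion
      have hAi : ∀ i, MemLp (A i σ) 2 volume := fun i => by
        simp only [hA]
        refine ⟨(ContinuousLinearMap.apply ℝ E (b i)).continuous.comp_aestronglyMeasurable hGσ, ?_⟩
        exact (eLpNorm_apply_le_lintegral_frobenius_rpow (Gv σ) (b i) (hb1 i)).trans_lt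
          (ENNReal.rpow_lt_top_of_nonneg (by norm_num) hD.ne)
      have hΦi : ∀ i, MemLp (ΦM M i s) 2 volume := fun i => by
        simp only [hΦM]
        have hsm : MemLp (fun x => ⟪ut (s, x), b i⟫ • {y | ‖ut (s, y)‖ < (M : ℝ)}.indicator
            (fun y => ut (s, y)) x) 2 volume := by
          refine ⟨(hus.inner stronglyMeasurable_const).aestronglyMeasurable.smul (hlt2 M).1, ?_⟩
          refine lt_of_le_of_lt (eLpNorm_mono (g := fun x => (M : ℝ) • ut (s, x)) fun x => ?_) ?_
          · rw [norm_smul, norm_smul, Real.norm_eq_abs, Real.norm_eq_abs,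
              abs_of_nonneg (Nat.cast_nonneg (α := ℝ) M)]
            calc |⟪ut (s, x), b i⟫| * ‖{y | ‖ut (s, y)‖ < (M : ℝ)}.indicator (fun y => ut (s, y)) x‖
                ≤ (‖ut (s, x)‖ * ‖b i‖) * M :=
                  mul_le_mul (abs_real_inner_le_norm _ _)
                    (norm_indicator_norm_lt_le (fun y => ut (s, y)) (Nat.cast_nonneg M) x)
                    (norm_nonneg _) (by positivity)
              _ = M * ‖ut (s, x)‖ := by rw [hb1, mul_one, mul_comm]
          · have : (fun x => (M : ℝ) • ut (s, x)) = (M : ℝ) • fun x => ut (s, x) := rfl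
            rw [this, eLpNorm_const_smul]
            exact ENNReal.mul_lt_top enorm_lt_top hmem2.2
        exact hsm
      have iΦA : ∀ i, Integrable (fun x => ⟪ΦM M i s x, A i σ x⟫) volume := fun i =>
        integrable_inner_of_memLp_two (hΦi i) (hAi i)
      refine ⟨iΦA, ?_⟩
      rw [← integral_finsetSum _ fun i _ => iΦA i]
      simp only [hTM]
      refine integral_congr_ae (ae_of_all _ fun x => ?_)
      dsimp only
      rw [inner_apply_eq_sum_frame (Gv σ x)]
      simp only [hΦM, hA]
      rfl
  -- ### a.e. consequences on the square and on the diagonal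
  have hsq : ∀ᵐ p ∂(νt.prod νt),
      (∫ x, ⟪Gv p.1 x (u p.2 x), u p.2 x⟫) = Tt p ∧
      (∀ M : ℕ, Tt p = TM M p + RM M p) ∧
      (∀ M : ℕ, TM M p = ∑ i, ∫ x, ⟪ΦM M i p.2 x, A i p.1 x⟫) := by
    filter_upwards [hgp] with p hp
    obtain ⟨h1, h2, h3, h4⟩ := key p.1 p.2 hp.1 hp.2.1 hp.2.2.1 hp.2.2.2
    exact ⟨h1, h3, fun M => (h4 M).2⟩
  have hdg : ∀ᵐ s ∂νt,
      (∫ x, ⟪Gv s x (u s x), u s x⟫) = Tt (s, s) ∧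
      (∀ M : ℕ, Tt (s, s) = TM M (s, s) + RM M (s, s)) ∧
      (∀ M : ℕ, TM M (s, s) = ∑ i, ∫ x, ⟪ΦM M i s x, A i s x⟫) := by
    filter_upwards [hgu, hgv] with s hs hDs
    obtain ⟨h1, h2, h3, h4⟩ := key s s hDs hs.2.1 hs.2.2.2.2.2.1 hs.2.2.2.2.2.2
    exact ⟨h1, h3, fun M => (h4 M).2⟩
  -- ### measurability of the diagonal remainders, and their integrability
  have hRMm : ∀ M : ℕ, StronglyMeasurable (RM M) := by
    intro M
    have h1 := stronglyMeasurable_integral_inner_apply h.hGvm h.hutm (h.hutm.indicator_le_norm (M : ℝ))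
    have : RM M = fun p : ℝ × ℝ => ∫ x, ⟪Gv p.1 x (ut (p.2, x)),
        {p : ℝ × E | (M : ℝ) ≤ ‖ut p‖}.indicator ut (p.2, x)⟫ := by
      rw [hRM]; funext p
      simp only [indicator_apply, mem_setOf_eq]
    rw [this]; exact h1
  have hTtm : StronglyMeasurable Tt := by
    rw [hTt]; exact stronglyMeasurable_integral_inner_apply h.hGvm h.hutm h.hutm
  -- the remainder bounds
  set Dv : ℝ≥0∞ := ∫⁻ σ in Ioo 0 t, ∫⁻ x, ENNReal.ofReal (frobeniusNormSq (Gv σ x)) with hDv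
  set Z : ℕ → ℝ≥0∞ := fun M => ∫⁻ s in Ioo 0 t, (eLpNorm (fun x => ut (s, x)) ((2⁻¹ - r⁻¹)⁻¹) volume *
    eLpNorm ({x | (M : ℝ) ≤ ‖ut (s, x)‖}.indicator fun x => ut (s, x)) r volume) ^ (2 : ℝ) with hZ
  set B : ℕ → ℝ≥0∞ := fun M => Dv ^ (1 / 2 : ℝ) * Z M ^ (1 / 2 : ℝ) with hB
  have hZle : ∀ M : ℕ, Z M ≤ ∫⁻ s in Ioo 0 T, (eLpNorm (fun x => ut (s, x)) ((2⁻¹ - r⁻¹)⁻¹) volume *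
      eLpNorm ({x | (M : ℝ) ≤ ‖ut (s, x)‖}.indicator fun x => ut (s, x)) r volume) ^ (2 : ℝ) :=
    fun M => lintegral_mono_set (Ioo_subset_Ioo le_rfl ht.2)
  have hZfin : ∀ M : ℕ, Z M < ⊤ := fun M =>
    lt_of_le_of_lt (hZle M) (h.lintegral_conj_mul_tail_sq_lt_top (M : ℝ))
  have hBfin : ∀ M : ℕ, B M < ⊤ := fun M => ENNReal.mul_lt_top
    (ENNReal.rpow_lt_top_of_nonneg (by norm_num) hGv₂t.ne)
    (ENNReal.rpow_lt_top_of_nonneg (by norm_num) (hZfin M).ne)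
  have hBlim : Tendsto B atTop (𝓝 0) := by
    have hZlim : Tendsto Z atTop (𝓝 0) :=
      tendsto_of_tendsto_of_tendsto_of_le_of_le tendsto_const_nhds
        (h.hu.tendsto_lintegral_conj_mul_tail_sq h.hE3 h.hr h.hqr h.hS h.hGum h.hGu h.hGu₂ h.hutm h.hut)
        (fun _ => bot_le) hZle
    have h1 : Tendsto (fun M => Z M ^ (1 / 2 : ℝ)) atTop (𝓝 0) := by
      have := ((ENNReal.continuous_rpow_const (y := 1 / 2)).tendsto (0 : ℝ≥0∞)).comp hZlim
      rwa [ENNReal.zero_rpow_of_pos (by norm_num)] at this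
    have h2 := ENNReal.Tendsto.const_mul h1 (a := Dv ^ (1 / 2 : ℝ))
      (Or.inr (ENNReal.rpow_ne_top_of_nonneg (by norm_num) hGv₂t.ne))
    rwa [mul_zero] at h2
  -- square remainder bound
  have hRsq : ∀ n M, ∫⁻ p, ‖(φ n).normed volume (p.2 - p.1) * RM M p‖ₑ ∂(νt.prod νt) ≤ B M := by
    intro n M
    have hmeas : AEMeasurable (fun p : ℝ × ℝ => ‖(φ n).normed volume (p.2 - p.1) * RM M p‖ₑ) (νt.prod νt) :=
      (((φ n).continuous_normed.comp (continuous_snd.sub continuous_fst)).aestronglyMeasurable.mul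
        (hRMm M).aestronglyMeasurable).enorm
    rw [lintegral_prod _ hmeas]
    have : ∀ σ s : ℝ, ‖(φ n).normed volume (s - σ) * RM M (σ, s)‖ₑ =
        ENNReal.ofReal ((φ n).normed volume (s - σ)) * ‖RM M (σ, s)‖ₑ := fun σ s => by
      rw [enorm_mul, Real.enorm_eq_ofReal ((φ n).nonneg_normed _)]
    simp only [this]
    rw [hRM]
    exact remainderA_le (φ n) h.hr h.hGvm h.hutm (M : ℝ)
  -- diagonal remainder bound
  have hRdg : ∀ M : ℕ, ∫⁻ s in Ioo 0 t, ‖RM M (s, s)‖ₑ ≤ B M := by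
    intro M
    rw [hRM]
    exact remainderA_diag_le h.hr h.hGvm h.hutm (M : ℝ)
  -- integrability on the square
  have hIT : ∀ n, Integrable (fun p => (φ n).normed volume (p.2 - p.1) * Tt p) (νt.prod νt) := by
    intro n
    obtain ⟨C, hC0, hC⟩ := FunctionSpaces.exists_normed_le (φ n)
    have h0 : Integrable Tt (νt.prod νt) := by
      have := h.hu.integrable_sq_tri h.hE3 h.hGum h.hGu h.hGu₂ h.hutm h.hut h.hGvm h.hGv₂
      rw [hTt]
      exact this.mono_measure (Measure.prod_mono (Measure.restrict_mono (Ioo_subset_Ioo le_rfl ht.2) le_rfl)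
        (Measure.restrict_mono (Ioo_subset_Ioo le_rfl ht.2) le_rfl))
    exact h0.bdd_mul (c := C)
      ((φ n).continuous_normed.comp (continuous_snd.sub continuous_fst)).aestronglyMeasurable
      (ae_of_all _ fun p => by
        rw [Real.norm_eq_abs, abs_of_nonneg ((φ n).nonneg_normed _)]; exact hC _)
  have hIJ : ∀ n M i, Integrable (fun p => (φ n).normed volume (p.2 - p.1) *
      ∫ x, ⟪ΦM M i p.2 x, A i p.1 x⟫) (νt.prod νt) := fun n M i =>
    integrable_sq_normed_mul_integral_inner (φ n) (hAm i) (hΦMm M i) (hA2 i) (hΦM2 M i)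
  have hITM : ∀ n M, Integrable (fun p => (φ n).normed volume (p.2 - p.1) * TM M p) (νt.prod νt) := by
    intro n M
    have hsum := integrable_finsetSum Finset.univ fun i _ => hIJ n M i
    refine hsum.congr ?_
    filter_upwards [hsq] with p hp
    rw [hp.2.2 M, Finset.mul_sum]
  have hIR : ∀ n M, Integrable (fun p => (φ n).normed volume (p.2 - p.1) * RM M p) (νt.prod νt) := by
    intro n M
    refine ((hIT n).sub (hITM n M)).congr ?_
    filter_upwards [hsq] with p hp
    simp only [Pi.sub_apply]
    rw [hp.2.1 M]; ring
  -- integrability on the diagonal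
  have hdiagm : ∀ M : ℕ, AEStronglyMeasurable (fun s => RM M (s, s)) νt := fun M =>
    ((hRMm M).comp_measurable (measurable_id.prodMk measurable_id)).aestronglyMeasurable
  have hIRd : ∀ M : ℕ, Integrable (fun s => RM M (s, s)) νt := fun M =>
    ⟨hdiagm M, lt_of_le_of_lt (hRdg M) (hBfin M)⟩
  have hITd : Integrable (fun s => Tt (s, s)) νt := by
    refine (hIRd 0).congr ?_
    filter_upwards [hdg] with s hs
    -- `RM 0 = Tt` on the diagonal: the part above height `0` is everything
    rw [hRM, hTt]
    dsimp only
    refine integral_congr_ae (ae_of_all _ fun x => ?_)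
    simp
  have hITMd : ∀ M : ℕ, Integrable (fun s => TM M (s, s)) νt := by
    intro M
    refine (hITd.sub (hIRd M)).congr ?_
    filter_upwards [hdg] with s hs
    simp only [Pi.sub_apply]
    rw [hs.2.1 M]; ring
  -- ### step 1: the truncated terms converge (fixed `M`)
  have hstep1 : ∀ M : ℕ, Tendsto (fun n => ∫ p, (φ n).normed volume (p.2 - p.1) * TM M p ∂(νt.prod νt))
      atTop (𝓝 (∫ s in Ioo 0 t, TM M (s, s))) := by
    intro M
    have hlim : ∀ i, Tendsto (fun n => ∫ p, (φ n).normed volume (p.2 - p.1) *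
        (∫ x, ⟪ΦM M i p.2 x, A i p.1 x⟫) ∂(νt.prod νt)) atTop
        (𝓝 (∫ z, ⟪ΦM M i z.1 z.2, A i z.1 z.2⟫ ∂(νt.prod (volume : Measure E)))) :=
      fun i => FunctionSpaces.tendsto_integral_normed_mul_integral_inner hφ (hAm i) (hΦMm M i) (hA2 i) (hΦM2 M i)
    have hsum := tendsto_finsetSum Finset.univ fun i _ => hlim i
    have hL : ∀ n, (∫ p, (φ n).normed volume (p.2 - p.1) * TM M p ∂(νt.prod νt)) =
        ∑ i, ∫ p, (φ n).normed volume (p.2 - p.1) * (∫ x, ⟪ΦM M i p.2 x, A i p.1 x⟫) ∂(νt.prod νt) := by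
      intro n
      rw [← integral_finsetSum _ fun i _ => hIJ n M i]
      refine integral_congr_ae ?_
      filter_upwards [hsq] with p hp
      rw [hp.2.2 M, Finset.mul_sum]
    have hint : ∀ i, Integrable (fun z : ℝ × E => ⟪ΦM M i z.1 z.2, A i z.1 z.2⟫)
        (νt.prod (volume : Measure E)) := fun i =>
      FunctionSpaces.integrable_inner_of_eLpNorm_two_lt_top (hΦMm M i).aestronglyMeasurable
        (hAm i).aestronglyMeasurable (hΦM2 M i) (hA2 i)
    have hR : (∑ i, ∫ z, ⟪ΦM M i z.1 z.2, A i z.1 z.2⟫ ∂(νt.prod (volume : Measure E))) =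
        ∫ s in Ioo 0 t, TM M (s, s) := by
      have h1 : ∀ i, (∫ z, ⟪ΦM M i z.1 z.2, A i z.1 z.2⟫ ∂(νt.prod (volume : Measure E))) =
          ∫ s, ∫ x, ⟪ΦM M i s x, A i s x⟫ ∂(volume : Measure E) ∂νt := fun i => integral_prod _ (hint i)
      have h2 : ∀ i, Integrable (fun s => ∫ x, ⟪ΦM M i s x, A i s x⟫ ∂(volume : Measure E)) νt :=
        fun i => (hint i).integral_prod_left
      rw [Finset.sum_congr rfl fun i _ => h1 i, ← integral_finsetSum _ fun i _ => h2 i]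
      refine integral_congr_ae ?_
      filter_upwards [hdg] with s hs
      rw [hs.2.2 M]
    rw [← hR]
    refine hsum.congr fun n => (hL n).symm
  -- ### step 2: uniform approximation
  have happrox : Tendsto (fun n => ∫ p, (φ n).normed volume (p.2 - p.1) * Tt p ∂(νt.prod νt))
      atTop (𝓝 (∫ s in Ioo 0 t, Tt (s, s))) := by
    refine tendsto_of_unif_approx (fun M n => ∫ p, (φ n).normed volume (p.2 - p.1) * TM M p ∂(νt.prod νt))
      (fun M => ∫ s in Ioo 0 t, TM M (s, s)) hstep1 fun ε hε => ?_
    obtain ⟨M, hM⟩ := (hBlim.eventually (gt_mem_nhds (ENNReal.ofReal_pos.2 hε))).exists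
    refine ⟨M, fun n => ?_, ?_⟩
    · rw [← integral_sub (hIT n) (hITM n M)]
      have heq : (fun p => (φ n).normed volume (p.2 - p.1) * Tt p - (φ n).normed volume (p.2 - p.1) * TM M p)
          =ᵐ[νt.prod νt] fun p => (φ n).normed volume (p.2 - p.1) * RM M p := by
        filter_upwards [hsq] with p hp
        rw [hp.2.1 M]; ring
      rw [integral_congr_ae heq, ← Real.norm_eq_abs, ← toReal_enorm, ← ENNReal.toReal_ofReal hε.le]
      refine ENNReal.toReal_mono ENNReal.ofReal_ne_top ?_
      exact ((enorm_integral_le_lintegral_enorm _).trans (hRsq n M)).trans hM.le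
    · rw [← integral_sub hITd (hITMd M)]
      have heq : (fun s => Tt (s, s) - TM M (s, s)) =ᵐ[νt] fun s => RM M (s, s) := by
        filter_upwards [hdg] with s hs
        rw [hs.2.1 M]; ring
      rw [integral_congr_ae heq, ← Real.norm_eq_abs, ← toReal_enorm, ← ENNReal.toReal_ofReal hε.le]
      refine ENNReal.toReal_mono ENNReal.ofReal_ne_top ?_
      exact ((enorm_integral_le_lintegral_enorm _).trans (hRdg M)).trans hM.le
  -- ### back to `u`
  have hL : ∀ n, (∫ p, (φ n).normed volume (p.2 - p.1) * (∫ x, ⟪Gv p.1 x (u p.2 x), u p.2 x⟫) ∂(νt.prod νt)) =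
      ∫ p, (φ n).normed volume (p.2 - p.1) * Tt p ∂(νt.prod νt) := fun n =>
    integral_congr_ae (by filter_upwards [hsq] with p hp; rw [hp.1])
  have hR : (∫ s in Ioo 0 t, ∫ x, ⟪Gv s x (u s x), u s x⟫) = ∫ s in Ioo 0 t, Tt (s, s) :=
    integral_congr_ae (by filter_upwards [hdg] with s hs; rw [hs.1])
  rw [hR]
  exact happrox.congr fun n => (hL n).symm

/-- `H¹ ∩ L² ⊂ L^p` for `2 ≤ p ≤ 6` in dimension `3` (Sobolev and interpolation). [folklore] -/
theorem memLp_of_hasWeakGradient (hE3 : finrank ℝ E = 3) {w : E → E} {G : E → E →L[ℝ] E}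
    (hw2 : MemLp w 2 volume) (hw : HasWeakGradient w G)
    (hG2 : ∫⁻ x, ENNReal.ofReal (frobeniusNormSq (G x)) < ⊤) {p : ℝ≥0∞} (h2p : 2 ≤ p) (hp6 : p ≤ 6) :
    MemLp w p volume := by
  refine ⟨hw2.1, lt_of_le_of_lt (eLpNorm_le_of_hasWeakGradient hE3 hw2 hw h2p hp6) ?_⟩
  have hptop : p ≠ ⊤ := ne_top_of_le_ne_top (by norm_num) hp6
  have h3 : 0 ≤ 3 / p.toReal - 1 / 2 := by
    have : p.toReal ≤ 6 := by
      rw [← ENNReal.toReal_ofNat 6]; exact ENNReal.toReal_mono (by norm_num) hp6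
    have hp0 : 0 < p.toReal := ENNReal.toReal_pos (lt_of_lt_of_le (by norm_num) h2p).ne' hptop
    rw [sub_nonneg, div_le_div_iff₀ (by positivity) hp0]; linarith
  have h3' : 0 ≤ 3 / 2 - 3 / p.toReal := by
    have : 2 ≤ p.toReal := by
      rw [← ENNReal.toReal_ofNat 2]; exact ENNReal.toReal_mono hptop h2p
    rw [sub_nonneg, div_le_div_iff₀ (by positivity) (by positivity)]; linarith
  exact ENNReal.mul_lt_top (ENNReal.rpow_lt_top_of_nonneg h3 hw2.2.ne)
    (ENNReal.rpow_lt_top_of_nonneg h3' (ENNReal.mul_lt_top ENNReal.coe_lt_top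
      (ENNReal.rpow_lt_top_of_nonneg (by norm_num) hG2.ne)).ne)

/-- **The B-side trilinear bulk limit** (Serrin 1963, §4; RRS 2016, proof of Lemma 8.18):
`∫∫ ρₙ(s-σ) ⟨(v(σ)·∇)u(s), v(σ)⟩ dσ ds → -∫₀ᵗ ⟨(v·∇)v, u⟩ ds`. Proof: at a.e. fixed `(σ, s)`,
`b(v,u,v) = -b(v,v,u)` (`integral_inner_weakGrad_apply_add_eq_zero` with the pairs `(3,6)`), so
the term is `-∫∫ρₙ ∫⟪ũ(s), Gv(σ)ṽ(σ)⟫`; truncating `ũ = ũ^{<M} + ũ^{≥M}`, the bounded part is an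
`L¹`–`L^∞` pairing (`tendsto_integral_normed_mul_integral_inner_of_bound`) and the remainders are
`≤ ‖N‖_{2/(1+θ)} ‖m_M‖_{2/(1-θ)}` uniformly in `n` (`remainderB_le`), small for large `M`. [cite: Serrin1963, §4] -/
theorem CrossData.tendsto_triB (h : CrossData E T ν u₀ u v q r Gu Gv ut vt) {t : ℝ}
    (ht : t ∈ Ioc 0 T) {φ : ℕ → ContDiffBump (0 : ℝ)}
    (hφ : Tendsto (fun n => (φ n).rOut) atTop (𝓝 0)) (h'φ : ∀ n, (φ n).rOut ≤ 2 * (φ n).rIn) :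
    Tendsto (fun n => ∫ p, (φ n).normed volume (p.2 - p.1) *
        (∫ x, ⟪Gu p.2 x (v p.1 x), v p.1 x⟫) ∂((volume.restrict (Ioo 0 t)).prod (volume.restrict (Ioo 0 t))))
      atTop (𝓝 (-∫ s in Ioo 0 t, ∫ x, ⟪Gv s x (v s x), u s x⟫)) := by
  classical
  haveI : ENNReal.HolderTriple 3 6 2 := holderTriple_three_six_two
  haveI := holderTriple_conj_two (r := r) (le_trans (by norm_num) h.hr.le)
  obtain ⟨hθ0, hθ1, hρq⟩ := serrin_exponent_props h.hr h.hqr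
  set θ : ℝ := ((3 : ℝ≥0∞) / r).toReal with hθ
  set q₀ : ℝ := 2 / (1 - θ) with hq₀
  have h1θ : 0 < 1 - θ := by linarith
  have hq₀0 : 0 < q₀ := div_pos two_pos h1θ
  set νt : Measure ℝ := volume.restrict (Ioo 0 t) with hνt
  haveI : IsFiniteMeasure νt := by rw [hνt]; infer_instance
  have hGv₂t : ∫⁻ s in Ioo 0 t, ∫⁻ x, ENNReal.ofReal (frobeniusNormSq (Gv s x)) < ⊤ :=
    lintegral_Ioo_mono_lt_top ht.2 h.hGv₂
  have hmono : νt.prod (volume : Measure E) ≤ (volume.restrict (Ioo 0 T)).prod (volume : Measure E) :=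
    Measure.prod_mono (Measure.restrict_mono (Ioo_subset_Ioo le_rfl ht.2) le_rfl) le_rfl
  have hmono2 : νt.prod νt ≤ (volume.restrict (Ioo 0 T)).prod (volume.restrict (Ioo 0 T)) :=
    Measure.prod_mono (Measure.restrict_mono (Ioo_subset_Ioo le_rfl ht.2) le_rfl)
      (Measure.restrict_mono (Ioo_subset_Ioo le_rfl ht.2) le_rfl)
  -- ### the objects
  obtain ⟨A, hA⟩ : ∃ F : ℝ → E → E, F = fun σ x => Gv σ x (vt (σ, x)) := ⟨_, rfl⟩
  obtain ⟨St, hSt⟩ : ∃ F : ℝ × ℝ → ℝ, F = fun p => ∫ x, ⟪ut (p.2, x), A p.1 x⟫ := ⟨_, rfl⟩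
  obtain ⟨RM, hRM⟩ : ∃ F : ℕ → ℝ × ℝ → ℝ, F = fun (M : ℕ) (p : ℝ × ℝ) =>
      ∫ x, ⟪{y | (M : ℝ) ≤ ‖ut (p.2, y)‖}.indicator (fun y => ut (p.2, y)) x, A p.1 x⟫ := ⟨_, rfl⟩
  obtain ⟨SM, hSM⟩ : ∃ F : ℕ → ℝ × ℝ → ℝ, F = fun (M : ℕ) (p : ℝ × ℝ) =>
      ∫ x, ⟪{y | ‖ut (p.2, y)‖ < (M : ℝ)}.indicator (fun y => ut (p.2, y)) x, A p.1 x⟫ := ⟨_, rfl⟩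
  obtain ⟨ΦM, hΦM⟩ : ∃ F : ℕ → ℝ → E → E, F = fun (M : ℕ) (s : ℝ) (x : E) =>
      {y | ‖ut (s, y)‖ < (M : ℝ)}.indicator (fun y => ut (s, y)) x := ⟨_, rfl⟩
  -- measurability / integrability of `A`, `ΦM`
  have hAm : StronglyMeasurable (uncurry A) := by
    rw [hA]
    exact isBoundedBilinearMap_apply.continuous.comp_stronglyMeasurable (h.hGvm.prodMk h.hvtm)
  have hA1 : Integrable (uncurry A) (νt.prod (volume : Measure E)) := by
    have := h.hv.integrable_grad_apply_version h.hvtm h.hvt h.hGvm h.hGv₂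
    rw [hA]
    exact this.mono_measure hmono
  have hΦMeq : ∀ M, uncurry (ΦM M) = {p : ℝ × E | ‖ut p‖ < (M : ℝ)}.indicator ut := by
    intro M; funext p
    simp only [hΦM, uncurry, indicator_apply, mem_setOf_eq, Prod.mk.eta]
  have hΦMm : ∀ M, StronglyMeasurable (uncurry (ΦM M)) := fun M => by
    rw [hΦMeq]; exact h.hutm.indicator_norm_lt (M : ℝ)
  have hΦMC : ∀ (M : ℕ) s x, ‖ΦM M s x‖ ≤ (M : ℝ) := fun M s x => by
    simp only [hΦM]
    exact norm_indicator_norm_lt_le (fun y => ut (s, y)) (Nat.cast_nonneg M) x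
  -- ### good times
  have hgu : ∀ᵐ s ∂νt, s ∈ Ioo 0 T ∧ MemLp (u s) 2 volume ∧ IsWeaklyDivFree (u s) ∧
      HasWeakGradient (u s) (Gu s) ∧ ∫⁻ x, ENNReal.ofReal (frobeniusNormSq (Gu s x)) < ⊤ ∧
      (u s =ᵐ[volume] fun x => ut (s, x)) ∧ MemLp (u s) r volume := by
    have h1 := ae_restrict_Ioo_of_le ht.2 (h.hu.ae_good h.hE3 h.hGum h.hGu h.hGu₂ h.hut)
    have h2 := ae_restrict_Ioo_of_le ht.2 h.hS.1
    filter_upwards [h1, h2] with s hs hsr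
    exact ⟨hs.1, hs.2.1, hs.2.2.1, hs.2.2.2.1, hs.2.2.2.2.1, hs.2.2.2.2.2.2, hsr⟩
  have hgv : ∀ᵐ σ ∂νt, σ ∈ Ioo 0 T ∧ MemLp (v σ) 2 volume ∧ IsWeaklyDivFree (v σ) ∧
      HasWeakGradient (v σ) (Gv σ) ∧ ∫⁻ x, ENNReal.ofReal (frobeniusNormSq (Gv σ x)) < ⊤ ∧
      (v σ =ᵐ[volume] fun x => vt (σ, x)) := by
    have h1 := ae_restrict_Ioo_of_le ht.2 (h.hv.ae_good h.hE3 h.hGvm h.hGv h.hGv₂ h.hvt)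
    filter_upwards [h1] with σ hσ
    exact ⟨hσ.1, hσ.2.1, hσ.2.2.1, hσ.2.2.2.1, hσ.2.2.2.2.1, hσ.2.2.2.2.2.2⟩
  -- ### pointwise facts at a good pair
  have key : ∀ σ s,
      (MemLp (v σ) 2 volume ∧ IsWeaklyDivFree (v σ) ∧ HasWeakGradient (v σ) (Gv σ) ∧
        ∫⁻ x, ENNReal.ofReal (frobeniusNormSq (Gv σ x)) < ⊤ ∧ (v σ =ᵐ[volume] fun x => vt (σ, x))) →
      (MemLp (u s) 2 volume ∧ HasWeakGradient (u s) (Gu s) ∧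
        ∫⁻ x, ENNReal.ofReal (frobeniusNormSq (Gu s x)) < ⊤ ∧ (u s =ᵐ[volume] fun x => ut (s, x)) ∧
        MemLp (u s) r volume) →
      (∫ x, ⟪Gu s x (v σ x), v σ x⟫) = -St (σ, s) ∧
      (∫ x, ⟪Gv σ x (v σ x), u s x⟫) = St (σ, s) ∧
      (∀ M : ℕ, St (σ, s) = SM M (σ, s) + RM M (σ, s)) ∧
      (∀ M : ℕ, SM M (σ, s) = ∫ x, ⟪ΦM M s x, A σ x⟫) := by
    intro σ s hV hU
    obtain ⟨hv2, hvdiv, hGvσ, hDv, hvsl⟩ := hV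
    obtain ⟨hu2, hGus, hDu, husl, hur⟩ := hU
    have hGσm : AEStronglyMeasurable (Gv σ) volume := (h.hGvm.of_uncurry_left (x := σ)).aestronglyMeasurable
    have hus : StronglyMeasurable fun x => ut (s, x) :=
      h.hutm.comp_measurable (measurable_const.prodMk measurable_id)
    -- Lebesgue memberships
    have hv3 : MemLp (v σ) 3 volume := memLp_of_hasWeakGradient h.hE3 hv2 hGvσ hDv (by norm_num) (by norm_num)
    have hv6 : MemLp (v σ) 6 volume := memLp_of_hasWeakGradient h.hE3 hv2 hGvσ hDv (by norm_num) (by norm_num)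
    have hu6 : MemLp (u s) 6 volume := memLp_of_hasWeakGradient h.hE3 hu2 hGus hDu (by norm_num) (by norm_num)
    obtain ⟨h2p, hp6, -, -⟩ := conj_exponent_props h.hr
    have hvp : MemLp (v σ) ((2⁻¹ - r⁻¹)⁻¹) volume := memLp_of_hasWeakGradient h.hE3 hv2 hGvσ hDv h2p hp6
    have hvtp : MemLp (fun x => vt (σ, x)) ((2⁻¹ - r⁻¹)⁻¹) volume := hvp.ae_eq hvsl
    have hutr : MemLp (fun x => ut (s, x)) r volume := hur.ae_eq husl
    have hSlt : ∀ M : ℕ, MeasurableSet {y | ‖ut (s, y)‖ < (M : ℝ)} := fun M =>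
      measurableSet_lt hus.norm.measurable measurable_const
    have hSge : ∀ M : ℕ, MeasurableSet {y | (M : ℝ) ≤ ‖ut (s, y)‖} := fun M =>
      measurableSet_le measurable_const hus.norm.measurable
    -- skew-symmetry `b(v, u, v) = -b(v, v, u)`
    have hskew := integral_inner_weakGrad_apply_add_eq_zero hvdiv hGus hGvσ hDu hDv hu2
      (q₁ := 3) (p₁ := 6) (q₂ := 3) (p₂ := 6) (by norm_num) (by norm_num) hv3 hv6 hv3 hu6
    -- integrability of the pairings in `x`
    have iS : Integrable (fun x => ⟪ut (s, x), A σ x⟫) volume := by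
      have := integrable_inner_apply_of_holder hGσm hDv hvtp hutr
      rw [hA]
      refine (this.congr (ae_of_all _ fun x => ?_))
      exact real_inner_comm _ _
    have iM : ∀ M : ℕ, Integrable (fun x => ⟪{y | ‖ut (s, y)‖ < (M : ℝ)}.indicator (fun y => ut (s, y)) x,
        A σ x⟫) volume := fun M => by
      have := integrable_inner_apply_of_holder hGσm hDv hvtp (hutr.indicator (hSlt M))
      rw [hA]
      refine (this.congr (ae_of_all _ fun x => ?_))
      exact real_inner_comm _ _
    have iR : ∀ M : ℕ, Integrable (fun x => ⟪{y | (M : ℝ) ≤ ‖ut (s, y)‖}.indicator (fun y => ut (s, y)) x,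
        A σ x⟫) volume := fun M => by
      have := integrable_inner_apply_of_holder hGσm hDv hvtp (hutr.indicator (hSge M))
      rw [hA]
      refine (this.congr (ae_of_all _ fun x => ?_))
      exact real_inner_comm _ _
    -- the version identity `∫⟪Gv v, u⟫ = St`
    have hver : (∫ x, ⟪Gv σ x (v σ x), u s x⟫) = St (σ, s) := by
      rw [hSt]
      dsimp only
      rw [hA]
      refine integral_congr_ae ?_
      filter_upwards [hvsl, husl] with x hxv hxu
      rw [hxv, hxu, real_inner_comm]
    refine ⟨?_, hver, fun M => ?_, fun M => ?_⟩
    · rw [← hver]; linarith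
    · rw [hSt, hSM, hRM]
      dsimp only
      rw [← integral_add (iM M) (iR M)]
      refine integral_congr_ae (ae_of_all _ fun x => ?_)
      dsimp only
      rw [← inner_add_left]
      congr 1
      have := congrFun (indicator_norm_lt_add_indicator_le (fun y => ut (s, y)) (M : ℝ)) x
      simpa only [Pi.add_apply] using this.symm
    · rw [hSM, hΦM]
  -- ### a.e. consequences
  have hsq : ∀ᵐ p ∂(νt.prod νt),
      (∫ x, ⟪Gu p.2 x (v p.1 x), v p.1 x⟫) = -St p ∧
      (∀ M : ℕ, St p = SM M p + RM M p) ∧ (∀ M : ℕ, SM M p = ∫ x, ⟪ΦM M p.2 x, A p.1 x⟫) := by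
    filter_upwards [(Measure.quasiMeasurePreserving_fst (μ := νt) (ν := νt)).ae hgv,
      (Measure.quasiMeasurePreserving_snd (μ := νt) (ν := νt)).ae hgu] with p hp1 hp2
    obtain ⟨h1, -, h3, h4⟩ := key p.1 p.2 hp1.2 ⟨hp2.2.1, hp2.2.2.2.1, hp2.2.2.2.2.1, hp2.2.2.2.2.2.1, hp2.2.2.2.2.2.2⟩
    exact ⟨h1, h3, h4⟩
  have hdg : ∀ᵐ s ∂νt,
      (∫ x, ⟪Gv s x (v s x), u s x⟫) = St (s, s) ∧
      (∀ M : ℕ, St (s, s) = SM M (s, s) + RM M (s, s)) ∧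
      (∀ M : ℕ, SM M (s, s) = ∫ x, ⟪ΦM M s x, A s x⟫) := by
    filter_upwards [hgv, hgu] with s hs1 hs2
    obtain ⟨-, h2, h3, h4⟩ := key s s hs1.2 ⟨hs2.2.1, hs2.2.2.2.1, hs2.2.2.2.2.1, hs2.2.2.2.2.2.1, hs2.2.2.2.2.2.2⟩
    exact ⟨h2, h3, h4⟩
  -- ### measurability of the objects
  have hStm : StronglyMeasurable St := by
    rw [hSt]
    have h1 := stronglyMeasurable_integral_inner_apply' h.hGvm h.hutm h.hvtm
    rw [hA]
    exact h1
  have hRMm : ∀ M : ℕ, StronglyMeasurable (RM M) := by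
    intro M
    have h1 := stronglyMeasurable_integral_inner_apply' h.hGvm (h.hutm.indicator_le_norm (M : ℝ)) h.hvtm
    have : RM M = fun p : ℝ × ℝ => ∫ x, ⟪{p : ℝ × E | (M : ℝ) ≤ ‖ut p‖}.indicator ut (p.2, x),
        Gv p.1 x (vt (p.1, x))⟫ := by
      rw [hRM, hA]; funext p
      simp only [indicator_apply, mem_setOf_eq]
    rw [this]; exact h1
  -- ### the remainder bound and its vanishing
  set W : ℝ≥0∞ := (∫⁻ σ in Ioo 0 t, ((∫⁻ x, ENNReal.ofReal (frobeniusNormSq (Gv σ x))) ^ (1 / 2 : ℝ) *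
    eLpNorm (fun x => vt (σ, x)) ((2⁻¹ - r⁻¹)⁻¹) volume) ^ (2 / (1 + θ))) ^ (1 / (2 / (1 + θ))) with hW
  set Y : ℕ → ℝ≥0∞ := fun M => ∫⁻ s in Ioo 0 t,
    eLpNorm ({x | (M : ℝ) ≤ ‖ut (s, x)‖}.indicator fun x => ut (s, x)) r volume ^ q₀ with hY
  set B : ℕ → ℝ≥0∞ := fun M => W * Y M ^ (1 / q₀) with hB
  have hWfin : W < ⊤ := by
    refine ENNReal.rpow_lt_top_of_nonneg (by positivity) (ne_of_lt ?_)
    exact lt_of_le_of_lt (lintegral_mono_set (Ioo_subset_Ioo le_rfl ht.2))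
      (h.hv.lintegral_weightB_lt_top h.hE3 h.hr h.hGv h.hGv₂ h.hvt)
  have hYle : ∀ M : ℕ, Y M ≤ ∫⁻ s in Ioo 0 T,
      eLpNorm ({x | (M : ℝ) ≤ ‖ut (s, x)‖}.indicator fun x => ut (s, x)) r volume ^ q₀ :=
    fun M => lintegral_mono_set (Ioo_subset_Ioo le_rfl ht.2)
  have hYfin : ∀ M : ℕ, Y M < ⊤ := by
    intro M
    refine lt_of_le_of_lt (hYle M) ?_
    have hvol : volume (Ioo 0 T) ≠ ⊤ := by rw [Real.volume_Ioo]; exact ENNReal.ofReal_ne_top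
    have hfin := FluidPDE.lintegral_rpow_eLpNorm_lt_top hvol h.hS hq₀0.le hρq
    have hslice := ae_slice_eq_of_uncurry_ae_eq h.hut
    refine lt_of_le_of_lt (lintegral_mono_ae ?_) hfin
    filter_upwards [hslice] with s hs
    rw [eLpNorm_congr_ae hs]
    exact ENNReal.rpow_le_rpow (eLpNorm_mono fun x => norm_indicator_le_norm_self _ _) hq₀0.le
  have hBfin : ∀ M : ℕ, B M < ⊤ := fun M =>
    ENNReal.mul_lt_top hWfin (ENNReal.rpow_lt_top_of_nonneg (by positivity) (hYfin M).ne)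
  have hBlim : Tendsto B atTop (𝓝 0) := by
    have hYlim : Tendsto Y atTop (𝓝 0) :=
      tendsto_of_tendsto_of_tendsto_of_le_of_le tendsto_const_nhds
        (tendsto_lintegral_tail_rpow h.hr h.hqr h.hS h.hutm h.hut) (fun _ => bot_le) hYle
    have h1 : Tendsto (fun M => Y M ^ (1 / q₀)) atTop (𝓝 0) := by
      have := ((ENNReal.continuous_rpow_const (y := 1 / q₀)).tendsto (0 : ℝ≥0∞)).comp hYlim
      rwa [ENNReal.zero_rpow_of_pos (by positivity)] at this
    have h2 := ENNReal.Tendsto.const_mul h1 (a := W) (Or.inr hWfin.ne)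
    rwa [mul_zero] at h2
  have hRsq : ∀ n M, ∫⁻ p, ‖(φ n).normed volume (p.2 - p.1) * RM M p‖ₑ ∂(νt.prod νt) ≤ B M := by
    intro n M
    have hmeas : AEMeasurable (fun p : ℝ × ℝ => ‖(φ n).normed volume (p.2 - p.1) * RM M p‖ₑ) (νt.prod νt) :=
      (((φ n).continuous_normed.comp (continuous_snd.sub continuous_fst)).aestronglyMeasurable.mul
        (hRMm M).aestronglyMeasurable).enorm
    rw [lintegral_prod _ hmeas]
    have : ∀ σ s : ℝ, ‖(φ n).normed volume (s - σ) * RM M (σ, s)‖ₑ =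
        ENNReal.ofReal ((φ n).normed volume (s - σ)) * ‖RM M (σ, s)‖ₑ := fun σ s => by
      rw [enorm_mul, Real.enorm_eq_ofReal ((φ n).nonneg_normed _)]
    simp only [this]
    rw [hRM, hA]
    exact remainderB_le (φ n) h.hr hθ1 h.hGvm h.hutm h.hvtm (M : ℝ)
  have hRdg : ∀ M : ℕ, ∫⁻ s in Ioo 0 t, ‖RM M (s, s)‖ₑ ≤ B M := by
    intro M
    rw [hRM, hA]
    exact remainderB_diag_le h.hr hθ1 h.hGvm h.hutm h.hvtm (M : ℝ)
  -- ### integrability on the square and the diagonal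
  have hISt : ∀ n, Integrable (fun p => (φ n).normed volume (p.2 - p.1) * St p) (νt.prod νt) := by
    intro n
    obtain ⟨C, hC0, hC⟩ := FunctionSpaces.exists_normed_le (φ n)
    -- `St = -(swap of the v-trilinear flux)` a.e., and the latter is integrable on the square
    have h0 : Integrable St (νt.prod νt) := by
      have h1 := (h.hv.integrable_sq_tri h.hE3 h.hGvm h.hGv h.hGv₂ h.hvtm h.hvt h.hGum h.hGu₂).swap
      have h2 : Integrable (fun p : ℝ × ℝ => ∫ x, ⟪Gu p.2 x (vt (p.1, x)), vt (p.1, x)⟫) (νt.prod νt) := by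
        have h3 := h1.mono_measure hmono2
        exact h3
      refine (h2.neg).congr ?_
      filter_upwards [hsq, (Measure.quasiMeasurePreserving_fst (μ := νt) (ν := νt)).ae hgv] with p hp hp1
      have hv' : (∫ x, ⟪Gu p.2 x (vt (p.1, x)), vt (p.1, x)⟫) = ∫ x, ⟪Gu p.2 x (v p.1 x), v p.1 x⟫ := by
        refine integral_congr_ae ?_
        filter_upwards [hp1.2.2.2.2.2] with x hx
        rw [hx]
      simp only [Pi.neg_apply]
      rw [hv', hp.1, neg_neg]
    exact h0.bdd_mul (c := C)
      ((φ n).continuous_normed.comp (continuous_snd.sub continuous_fst)).aestronglyMeasurable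
      (ae_of_all _ fun p => by
        rw [Real.norm_eq_abs, abs_of_nonneg ((φ n).nonneg_normed _)]; exact hC _)
  have hISM : ∀ n M, Integrable (fun p => (φ n).normed volume (p.2 - p.1) * SM M p) (νt.prod νt) := by
    intro n M
    have h1 := integrable_sq_normed_mul_integral_inner_of_bound (φ n) hAm (hΦMm M) hA1 (hΦMC M)
    refine h1.congr ?_
    filter_upwards [hsq] with p hp
    rw [hp.2.2 M]
  have hIR : ∀ n M, Integrable (fun p => (φ n).normed volume (p.2 - p.1) * RM M p) (νt.prod νt) := by
    intro n M
    refine ((hISt n).sub (hISM n M)).congr ?_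
    filter_upwards [hsq] with p hp
    simp only [Pi.sub_apply]
    rw [hp.2.1 M]; ring
  have hIRd : ∀ M : ℕ, Integrable (fun s => RM M (s, s)) νt := fun M =>
    ⟨((hRMm M).comp_measurable (measurable_id.prodMk measurable_id)).aestronglyMeasurable,
      lt_of_le_of_lt (hRdg M) (hBfin M)⟩
  have hIStd : Integrable (fun s => St (s, s)) νt := by
    refine (hIRd 0).congr ?_
    filter_upwards [hdg] with s hs
    rw [hRM, hSt]
    dsimp only
    refine integral_congr_ae (ae_of_all _ fun x => ?_)
    simp
  have hISMd : ∀ M : ℕ, Integrable (fun s => SM M (s, s)) νt := by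
    intro M
    refine (hIStd.sub (hIRd M)).congr ?_
    filter_upwards [hdg] with s hs
    simp only [Pi.sub_apply]
    rw [hs.2.1 M]; ring
  -- ### step 1: truncated terms (fixed `M`)
  have hstep1 : ∀ M : ℕ, Tendsto (fun n => ∫ p, (φ n).normed volume (p.2 - p.1) * SM M p ∂(νt.prod νt))
      atTop (𝓝 (∫ s in Ioo 0 t, SM M (s, s))) := by
    intro M
    have hlim := FunctionSpaces.tendsto_integral_normed_mul_integral_inner_of_bound hφ h'φ hAm (hΦMm M) hA1 (hΦMC M)
    have hL : ∀ n, (∫ p, (φ n).normed volume (p.2 - p.1) * SM M p ∂(νt.prod νt)) =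
        ∫ p, (φ n).normed volume (p.2 - p.1) * (∫ x, ⟪ΦM M p.2 x, A p.1 x⟫) ∂(νt.prod νt) := fun n =>
      integral_congr_ae (by filter_upwards [hsq] with p hp; rw [hp.2.2 M])
    have hint : Integrable (fun z : ℝ × E => ⟪ΦM M z.1 z.2, A z.1 z.2⟫) (νt.prod (volume : Measure E)) := by
      refine Integrable.mono' (hA1.norm.const_mul (M : ℝ))
        ((hΦMm M).aestronglyMeasurable.inner (𝕜 := ℝ) hAm.aestronglyMeasurable) (ae_of_all _ fun z => ?_)
      exact (norm_inner_le_norm (𝕜 := ℝ) _ _).trans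
        (mul_le_mul_of_nonneg_right (hΦMC M z.1 z.2) (norm_nonneg _))
    have hR : (∫ z, ⟪ΦM M z.1 z.2, A z.1 z.2⟫ ∂(νt.prod (volume : Measure E))) = ∫ s in Ioo 0 t, SM M (s, s) := by
      rw [integral_prod _ hint]
      refine integral_congr_ae ?_
      filter_upwards [hdg] with s hs
      rw [hs.2.2 M]
    rw [← hR]
    exact hlim.congr fun n => (hL n).symm
  -- ### step 2: uniform approximation
  have happrox : Tendsto (fun n => ∫ p, (φ n).normed volume (p.2 - p.1) * St p ∂(νt.prod νt))
      atTop (𝓝 (∫ s in Ioo 0 t, St (s, s))) := by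
    refine tendsto_of_unif_approx (fun M n => ∫ p, (φ n).normed volume (p.2 - p.1) * SM M p ∂(νt.prod νt))
      (fun M => ∫ s in Ioo 0 t, SM M (s, s)) hstep1 fun ε hε => ?_
    obtain ⟨M, hM⟩ := (hBlim.eventually (gt_mem_nhds (ENNReal.ofReal_pos.2 hε))).exists
    refine ⟨M, fun n => ?_, ?_⟩
    · rw [← integral_sub (hISt n) (hISM n M)]
      have heq : (fun p => (φ n).normed volume (p.2 - p.1) * St p - (φ n).normed volume (p.2 - p.1) * SM M p)
          =ᵐ[νt.prod νt] fun p => (φ n).normed volume (p.2 - p.1) * RM M p := by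
        filter_upwards [hsq] with p hp
        rw [hp.2.1 M]; ring
      rw [integral_congr_ae heq, ← Real.norm_eq_abs, ← toReal_enorm, ← ENNReal.toReal_ofReal hε.le]
      refine ENNReal.toReal_mono ENNReal.ofReal_ne_top ?_
      exact ((enorm_integral_le_lintegral_enorm _).trans (hRsq n M)).trans hM.le
    · rw [← integral_sub hIStd (hISMd M)]
      have heq : (fun s => St (s, s) - SM M (s, s)) =ᵐ[νt] fun s => RM M (s, s) := by
        filter_upwards [hdg] with s hs
        rw [hs.2.1 M]; ring
      rw [integral_congr_ae heq, ← Real.norm_eq_abs, ← toReal_enorm, ← ENNReal.toReal_ofReal hε.le]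
      refine ENNReal.toReal_mono ENNReal.ofReal_ne_top ?_
      exact ((enorm_integral_le_lintegral_enorm _).trans (hRdg M)).trans hM.le
  -- ### back to `u`, `v`
  have hL : ∀ n, (∫ p, (φ n).normed volume (p.2 - p.1) * (∫ x, ⟪Gu p.2 x (v p.1 x), v p.1 x⟫) ∂(νt.prod νt)) =
      -∫ p, (φ n).normed volume (p.2 - p.1) * St p ∂(νt.prod νt) := by
    intro n
    rw [← integral_neg]
    refine integral_congr_ae ?_
    filter_upwards [hsq] with p hp
    rw [hp.1]; ring
  have hR : (∫ s in Ioo 0 t, ∫ x, ⟪Gv s x (v s x), u s x⟫) = ∫ s in Ioo 0 t, St (s, s) :=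
    integral_congr_ae (by filter_upwards [hdg] with s hs; rw [hs.1])
  rw [hR]
  refine (happrox.neg).congr fun n => (hL n).symm

end Bulk

/-! ### Integrability of the diagonal terms -/

section Diagonal

variable {T ν : ℝ} {u₀ : E → E} {u v : ℝ → E → E} {q r : ℝ≥0∞} {Gu Gv : ℝ → E → E →L[ℝ] E}
  {ut vt : ℝ × E → E}

/-- **`s ↦ b(u,v,u)(s) = ∫⟪Gv(s)u(s), u(s)⟫` is integrable on `(0,T)`** (the Serrin condition:
`|b(u,v,u)| ≤ ‖∇v‖₂ ‖u‖_p ‖u‖_r` with `‖u‖_p ≤ C‖∇u‖₂^θ`; RRS 2016, Lemma 8.16 / proof of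
Lemma 8.18). [cite: RobinsonRodrigoSadowski2016, Lemma 8.16] -/
theorem CrossData.integrableOn_triA_diag (h : CrossData E T ν u₀ u v q r Gu Gv ut vt) :
    IntegrableOn (fun s => ∫ x, ⟪Gv s x (u s x), u s x⟫) (Ioo 0 T) := by
  -- measurability through the versions
  have hm0 : StronglyMeasurable fun p : ℝ × ℝ => ∫ x, ⟪Gv p.1 x (ut (p.2, x)), ut (p.2, x)⟫ :=
    stronglyMeasurable_integral_inner_apply h.hGvm h.hutm h.hutm
  have hslice := ae_slice_eq_of_uncurry_ae_eq h.hut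
  have hae : (fun s => ∫ x, ⟪Gv s x (ut (s, x)), ut (s, x)⟫) =ᵐ[volume.restrict (Ioo 0 T)]
      fun s => ∫ x, ⟪Gv s x (u s x), u s x⟫ := by
    filter_upwards [hslice] with s hs
    refine integral_congr_ae ?_
    filter_upwards [hs] with x hx
    rw [hx]
  refine Integrable.congr ?_ hae
  refine ⟨(hm0.comp_measurable (measurable_id.prodMk measurable_id)).aestronglyMeasurable, ?_⟩
  -- the bound with `M = 0`
  have hb := remainderA_diag_le (t := T) h.hr h.hGvm h.hutm (0 : ℝ)
  have hZ := h.lintegral_conj_mul_tail_sq_lt_top (0 : ℝ)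
  have hfin : (∫⁻ σ in Ioo 0 T, ∫⁻ x, ENNReal.ofReal (frobeniusNormSq (Gv σ x))) ^ (1 / 2 : ℝ) *
      (∫⁻ s in Ioo 0 T, (eLpNorm (fun x => ut (s, x)) ((2⁻¹ - r⁻¹)⁻¹) volume *
        eLpNorm ({x | (0 : ℝ) ≤ ‖ut (s, x)‖}.indicator fun x => ut (s, x)) r volume) ^ (2 : ℝ))
        ^ (1 / 2 : ℝ) < ⊤ :=
    ENNReal.mul_lt_top (ENNReal.rpow_lt_top_of_nonneg (by norm_num) h.hGv₂.ne)
      (ENNReal.rpow_lt_top_of_nonneg (by norm_num) hZ.ne)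
  refine lt_of_le_of_lt (le_trans (lintegral_congr fun s => ?_).le hb) hfin
  congr 2
  refine integral_congr_ae (ae_of_all _ fun x => ?_)
  simp

/-- **`s ↦ b(v,v,u)(s) = ∫⟪Gv(s)v(s), u(s)⟫` is integrable on `(0,T)`**
(`|b(v,v,u)| ≤ ‖∇v‖₂ ‖v‖_p ‖u‖_r ∈ L¹(0,T)` by Hölder in time with the conjugate Serrin exponents;
RRS 2016, Lemma 8.16 / proof of Lemma 8.18). [cite: RobinsonRodrigoSadowski2016, Lemma 8.16] -/
theorem CrossData.integrableOn_triB_diag (h : CrossData E T ν u₀ u v q r Gu Gv ut vt) :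
    IntegrableOn (fun s => ∫ x, ⟪Gv s x (v s x), u s x⟫) (Ioo 0 T) := by
  obtain ⟨hθ0, hθ1, hρq⟩ := serrin_exponent_props h.hr h.hqr
  set θ : ℝ := ((3 : ℝ≥0∞) / r).toReal with hθ
  have h1θ : 0 < 1 - θ := by linarith
  have hm0 : StronglyMeasurable fun p : ℝ × ℝ => ∫ x, ⟪ut (p.2, x), Gv p.1 x (vt (p.1, x))⟫ :=
    stronglyMeasurable_integral_inner_apply' h.hGvm h.hutm h.hvtm
  have hsu := ae_slice_eq_of_uncurry_ae_eq h.hut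
  have hsv := ae_slice_eq_of_uncurry_ae_eq h.hvt
  have hae : (fun s => ∫ x, ⟪ut (s, x), Gv s x (vt (s, x))⟫) =ᵐ[volume.restrict (Ioo 0 T)]
      fun s => ∫ x, ⟪Gv s x (v s x), u s x⟫ := by
    filter_upwards [hsu, hsv] with s hs hs'
    refine integral_congr_ae ?_
    filter_upwards [hs, hs'] with x hx hx'
    rw [hx, hx', real_inner_comm]
  refine Integrable.congr ?_ hae
  refine ⟨(hm0.comp_measurable (measurable_id.prodMk measurable_id)).aestronglyMeasurable, ?_⟩
  have hb := remainderB_diag_le (t := T) h.hr hθ1 h.hGvm h.hutm h.hvtm (0 : ℝ)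
  have hW := h.hv.lintegral_weightB_lt_top h.hE3 h.hr h.hGv h.hGv₂ h.hvt
  have hY : ∫⁻ s in Ioo 0 T, eLpNorm ({x | (0 : ℝ) ≤ ‖ut (s, x)‖}.indicator fun x => ut (s, x)) r volume
      ^ (2 / (1 - θ)) < ⊤ := by
    have hvol : volume (Ioo 0 T) ≠ ⊤ := by rw [Real.volume_Ioo]; exact ENNReal.ofReal_ne_top
    have hfin := FluidPDE.lintegral_rpow_eLpNorm_lt_top hvol h.hS (div_pos two_pos h1θ).le hρq
    refine lt_of_le_of_lt (lintegral_mono_ae ?_) hfin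
    filter_upwards [hsu] with s hs
    rw [eLpNorm_congr_ae hs]
    exact ENNReal.rpow_le_rpow (eLpNorm_mono fun x => norm_indicator_le_norm_self _ _)
      (div_pos two_pos h1θ).le
  have hfin : (∫⁻ σ in Ioo 0 T, ((∫⁻ x, ENNReal.ofReal (frobeniusNormSq (Gv σ x))) ^ (1 / 2 : ℝ) *
        eLpNorm (fun x => vt (σ, x)) ((2⁻¹ - r⁻¹)⁻¹) volume) ^ (2 / (1 + θ))) ^ (1 / (2 / (1 + θ))) *
      (∫⁻ s in Ioo 0 T, eLpNorm ({x | (0 : ℝ) ≤ ‖ut (s, x)‖}.indicator fun x => ut (s, x)) r volume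
        ^ (2 / (1 - θ))) ^ (1 / (2 / (1 - θ))) < ⊤ :=
    ENNReal.mul_lt_top (ENNReal.rpow_lt_top_of_nonneg (by positivity) hW.ne)
      (ENNReal.rpow_lt_top_of_nonneg (by positivity) hY.ne)
  refine lt_of_le_of_lt (le_trans (lintegral_congr fun s => ?_).le hb) hfin
  congr 2
  refine integral_congr_ae (ae_of_all _ fun x => ?_)
  simp

/-- **`s ↦ Σᵢ ∫⟪Gu(s)eᵢ, Gv(s)eᵢ⟫` is integrable on `(0,T)`** (Cauchy–Schwarz in space and time). [folklore] -/
theorem CrossData.integrableOn_grad_diag (h : CrossData E T ν u₀ u v q r Gu Gv ut vt) :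
    IntegrableOn (fun s => ∑ i, ∫ x,
      ⟪Gu s x (stdOrthonormalBasis ℝ E i), Gv s x (stdOrthonormalBasis ℝ E i)⟫) (Ioo 0 T) := by
  set b := stdOrthonormalBasis ℝ E with hb
  have hb1 : ∀ i, ‖b i‖ = 1 := fun i => b.orthonormal.1 i
  set Du : ℝ → ℝ≥0∞ := fun s => ∫⁻ x, ENNReal.ofReal (frobeniusNormSq (Gu s x)) with hDu
  set Dv : ℝ → ℝ≥0∞ := fun s => ∫⁻ x, ENNReal.ofReal (frobeniusNormSq (Gv s x)) with hDv
  have hDum : Measurable Du := measurable_lintegral_frobeniusNormSq h.hGum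
  have hDvm : Measurable Dv := measurable_lintegral_frobeniusNormSq h.hGvm
  refine integrable_finsetSum _ fun i _ => ?_
  have hm : StronglyMeasurable fun p : ℝ × ℝ => ∫ x, ⟪Gu p.2 x (b i), Gv p.1 x (b i)⟫ :=
    stronglyMeasurable_integral_inner_grad h.hGum h.hGvm (b i)
  refine ⟨(hm.comp_measurable (measurable_id.prodMk measurable_id)).aestronglyMeasurable, ?_⟩
  have hpt : ∀ s, ‖∫ x, ⟪Gu s x (b i), Gv s x (b i)⟫‖ₑ ≤ Du s ^ (1 / 2 : ℝ) * Dv s ^ (1 / 2 : ℝ) := by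
    intro s
    have h1 := enorm_integral_inner_apply_apply_le (Gu s) (Gv s)
      (h.hGum.of_uncurry_left (x := s)).aestronglyMeasurable
      (h.hGvm.of_uncurry_left (x := s)).aestronglyMeasurable (b i) (hb1 i)
    exact h1.trans (mul_le_mul' (eLpNorm_apply_le_lintegral_frobenius_rpow (Gu s) (b i) (hb1 i)) le_rfl)
  calc ∫⁻ s in Ioo 0 T, ‖∫ x, ⟪Gu s x (b i), Gv s x (b i)⟫‖ₑ
      ≤ ∫⁻ s in Ioo 0 T, Du s ^ (1 / 2 : ℝ) * Dv s ^ (1 / 2 : ℝ) := lintegral_mono fun s => hpt s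
    _ ≤ (∫⁻ s in Ioo 0 T, (Du s ^ (1 / 2 : ℝ)) ^ (2 : ℝ)) ^ (1 / (2 : ℝ)) *
          (∫⁻ s in Ioo 0 T, (Dv s ^ (1 / 2 : ℝ)) ^ (2 : ℝ)) ^ (1 / (2 : ℝ)) :=
        ENNReal.lintegral_mul_le_Lp_mul_Lq _ Real.HolderConjugate.two_two
          (hDum.pow_const _).aemeasurable (hDvm.pow_const _).aemeasurable
    _ = (∫⁻ s in Ioo 0 T, Du s) ^ (1 / 2 : ℝ) * (∫⁻ s in Ioo 0 T, Dv s) ^ (1 / 2 : ℝ) := by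
        congr 2 <;> exact lintegral_congr fun s => by rw [← ENNReal.rpow_mul]; norm_num
    _ < ⊤ := ENNReal.mul_lt_top (ENNReal.rpow_lt_top_of_nonneg (by norm_num) h.hGu₂.ne)
          (ENNReal.rpow_lt_top_of_nonneg (by norm_num) h.hGv₂.ne)

end Diagonal

/-! ### The cross identity -/

section Cross

variable {T ν : ℝ} {u₀ : E → E} {u v : ℝ → E → E} {q r : ℝ≥0∞} {Gu Gv : ℝ → E → E →L[ℝ] E}
  {ut vt : ℝ × E → E}

/-- One-sided limits along `(0, t)` from continuity on `(0, T]`. [folklore] -/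
theorem tendsto_nhdsLT_of_continuousOn_Ioc {F : ℝ → ℝ} {t : ℝ} (hT : t ≤ T) (ht : 0 < t)
    (hF : ContinuousOn F (Ioc 0 T)) : Tendsto F (𝓝[<] t) (𝓝 (F t)) := by
  have h1 : Tendsto F (𝓝[Ioc 0 T] t) (𝓝 (F t)) := hF t ⟨ht, hT⟩
  have h2 : 𝓝[Ioo 0 t] t ≤ 𝓝[Ioc 0 T] t := nhdsWithin_mono _ fun x hx => ⟨hx.1, hx.2.le.trans hT⟩
  rw [← nhdsWithin_Ioo_eq_nhdsLT ht]
  exact h1.mono_left h2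

/-- **Serrin's cross identity** (Serrin 1963, §4; Robinson–Rodrigo–Sadowski 2016, proof of
Thm. 6.10, third display, and Lemma 8.18; Sohr 2001, Thm. V.1.4.1): for two Leray–Hopf solutions
`u` (Serrin class) and `v` with common datum `u₀ ∈ L²` and every `t ∈ (0,T]`,
`⟨u(t), v(t)⟩ = ‖u₀‖² + ∫₀ᵗ ( b(u,v,u) - b(v,v,u) - 2ν ⟨∇u, ∇v⟩ ) ds`
with `b(u,v,u) = ∫⟪Gv u, u⟫`, `b(v,v,u) = ∫⟪Gv v, u⟫`, `⟨∇u,∇v⟩ = Σᵢ ∫⟪Gu eᵢ, Gv eᵢ⟫`.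
Proof: the abstract doubling identity `Literature.Analysis.FunctionSpaces.doubling_identity` for `Q(s,σ) = ⟨u(s), v(σ)⟩`, whose
one-sided representations are the `H¹_σ` time-slice identities of `u` tested with `v(σ)` and of `v`
tested with `u(s)` (`Fluid.IsLerayHopfOn.inner_weakGrad_test_eq`), the boundary limits coming
from weak `L²` continuity, and the bulk limits `tendsto_grad`, `tendsto_triA`, `tendsto_triB`. [cite: Serrin1963, §4] -/
theorem CrossData.cross_identity (h : CrossData E T ν u₀ u v q r Gu Gv ut vt) {t : ℝ}
    (ht : t ∈ Ioc 0 T) :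
    ∫ x, ⟪u t x, v t x⟫ = (∫ x, ⟪u₀ x, u₀ x⟫) +
      ∫ s in Ioo 0 t, ((∫ x, ⟪Gv s x (u s x), u s x⟫) - (∫ x, ⟪Gv s x (v s x), u s x⟫)
        - 2 * ν * ∑ i, ∫ x, ⟪Gu s x (stdOrthonormalBasis ℝ E i), Gv s x (stdOrthonormalBasis ℝ E i)⟫) := by
  obtain ⟨φ, hφ, h'φ⟩ := FunctionSpaces.exists_contDiffBump_seq (E := ℝ)
  set νt : Measure ℝ := volume.restrict (Ioo 0 t) with hνt
  haveI : IsFiniteMeasure νt := by rw [hνt]; infer_instance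
  have htT : Ioo (0 : ℝ) t ⊆ Ioo 0 T := Ioo_subset_Ioo le_rfl ht.2
  have hν0 : 0 ≤ ν := h.hν.le
  have hmono2 : νt.prod νt ≤ (volume.restrict (Ioo 0 T)).prod (volume.restrict (Ioo 0 T)) :=
    Measure.prod_mono (Measure.restrict_mono htT le_rfl) (Measure.restrict_mono htT le_rfl)
  -- ### the data of the doubling identity
  set K₀ : ℝ := VectorCalculus.kineticEnergy u₀ with hK₀
  obtain ⟨Q, hQ⟩ : ∃ F : ℝ → ℝ → ℝ, F = fun s σ => ∫ x, ⟪u s x, v σ x⟫ := ⟨_, rfl⟩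
  obtain ⟨c, hc⟩ : ∃ F : ℝ → ℝ, F = fun σ => ∫ x, ⟪u₀ x, v σ x⟫ := ⟨_, rfl⟩
  obtain ⟨c', hc'⟩ : ∃ F : ℝ → ℝ, F = fun s => ∫ x, ⟪u₀ x, u s x⟫ := ⟨_, rfl⟩
  obtain ⟨f, hf⟩ : ∃ F : ℝ → ℝ → ℝ, F = fun σ τ => (∫ x, ⟪Gv σ x (u τ x), u τ x⟫) -
      ν * ∑ i, ∫ x, ⟪Gu τ x (stdOrthonormalBasis ℝ E i), Gv σ x (stdOrthonormalBasis ℝ E i)⟫ := ⟨_, rfl⟩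
  obtain ⟨g, hg⟩ : ∃ F : ℝ → ℝ → ℝ, F = fun s τ => (∫ x, ⟪Gu s x (v τ x), v τ x⟫) -
      ν * ∑ i, ∫ x, ⟪Gv τ x (stdOrthonormalBasis ℝ E i), Gu s x (stdOrthonormalBasis ℝ E i)⟫ := ⟨_, rfl⟩
  -- the limits
  set TA : ℝ := ∫ s in Ioo 0 t, ∫ x, ⟪Gv s x (u s x), u s x⟫ with hTA
  set TB : ℝ := ∫ s in Ioo 0 t, ∫ x, ⟪Gv s x (v s x), u s x⟫ with hTB
  set Γ : ℝ := ∫ s in Ioo 0 t, ∑ i, ∫ x,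
    ⟪Gu s x (stdOrthonormalBasis ℝ E i), Gv s x (stdOrthonormalBasis ℝ E i)⟫ with hΓ
  -- ### measurability of `Q`
  have hsu : ∀ᵐ s ∂νt, u s =ᵐ[volume] fun x => ut (s, x) :=
    ae_restrict_Ioo_of_le ht.2 (ae_slice_eq_of_uncurry_ae_eq h.hut)
  have hsv : ∀ᵐ σ ∂νt, v σ =ᵐ[volume] fun x => vt (σ, x) :=
    ae_restrict_Ioo_of_le ht.2 (ae_slice_eq_of_uncurry_ae_eq h.hvt)
  have hQm : AEStronglyMeasurable (fun p : ℝ × ℝ => Q p.2 p.1) (νt.prod νt) := by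
    have h1 : StronglyMeasurable fun p : ℝ × ℝ => ∫ x, ⟪ut (p.2, x), vt (p.1, x)⟫ := by
      have h2 : StronglyMeasurable fun z : (ℝ × ℝ) × E => ⟪ut (z.1.2, z.2), vt (z.1.1, z.2)⟫ :=
        (h.hutm.comp_measurable (measurable_fst.snd.prodMk measurable_snd)).inner (𝕜 := ℝ)
          (h.hvtm.comp_measurable (measurable_fst.fst.prodMk measurable_snd))
      exact h2.integral_prod_right'
    refine h1.aestronglyMeasurable.congr ?_
    filter_upwards [(Measure.quasiMeasurePreserving_fst (μ := νt) (ν := νt)).ae hsv,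
      (Measure.quasiMeasurePreserving_snd (μ := νt) (ν := νt)).ae hsu] with p hp1 hp2
    rw [hQ]
    refine integral_congr_ae ?_
    filter_upwards [hp1, hp2] with x hx1 hx2
    rw [hx1, hx2]
  -- ### boundedness
  have hKu : ∀ s ∈ Icc 0 T, VectorCalculus.kineticEnergy (u s) ≤ K₀ := fun s hs =>
    kineticEnergy_le_of_energy_ineq hν0 h.hEu hs
  have hKv : ∀ s ∈ Icc 0 T, VectorCalculus.kineticEnergy (v s) ≤ K₀ := fun s hs =>
    kineticEnergy_le_of_energy_ineq hν0 h.hEv hs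
  have hIoc : ∀ s ∈ Ioc 0 t, s ∈ Icc 0 T := fun s hs => ⟨hs.1.le, hs.2.trans ht.2⟩
  have hQb : ∀ s ∈ Ioc 0 t, ∀ σ ∈ Ioc 0 t, |Q s σ| ≤ K₀ + K₀ := by
    intro s hs σ hσ
    rw [hQ]
    exact (abs_integral_inner_le_kineticEnergy_add (h.hu.memLp s (hIoc s hs)) (h.hv.memLp σ (hIoc σ hσ))).trans
      (add_le_add (hKu s (hIoc s hs)) (hKv σ (hIoc σ hσ)))
  -- ### the two representations
  have hgv := ae_restrict_Ioo_of_le ht.2 (h.hv.ae_good h.hE3 h.hGvm h.hGv h.hGv₂ h.hvt)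
  have hgu := ae_restrict_Ioo_of_le ht.2 (h.hu.ae_good h.hE3 h.hGum h.hGu h.hGu₂ h.hut)
  have hA : ∀ᵐ σ ∂νt, IntegrableOn (f σ) (Ioo 0 t) ∧ ∀ s ∈ Ioc 0 t, Q s σ = c σ + ∫ τ in Ioo 0 s, f σ τ := by
    filter_upwards [hgv] with σ hσ
    obtain ⟨-, hv2, hvdiv, hGvσ, hDv, -, -⟩ := hσ
    have hGσm : AEStronglyMeasurable (Gv σ) volume := hGvσ.aestronglyMeasurable_deriv
    refine ⟨?_, fun s hs => ?_⟩
    · have h1 := h.hu.integrableOn_weakFlux h.hE3 h.hGum h.hGu h.hGu₂ hGσm hDv (ν := ν)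
      rw [hf]
      exact h1.mono_set htT
    · have h1 := h.hu.inner_weakGrad_test_eq h.hE3 h.hu₀ h.hT h.hGum h.hGu h.hGu₂ hv2 hvdiv hGvσ hDv
        (t := s) ⟨hs.1, hs.2.trans ht.2⟩
      rw [hQ, hc, hf]
      dsimp only
      rw [h1, setIntegral_congr_set Ioo_ae_eq_Ioc]
  have hB : ∀ᵐ s ∂νt, IntegrableOn (g s) (Ioo 0 t) ∧ ∀ σ ∈ Ioc 0 t, Q s σ = c' s + ∫ τ in Ioo 0 σ, g s τ := by
    filter_upwards [hgu] with s hs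
    obtain ⟨-, hu2, hudiv, hGus, hDu, -, -⟩ := hs
    have hGsm : AEStronglyMeasurable (Gu s) volume := hGus.aestronglyMeasurable_deriv
    refine ⟨?_, fun σ hσ => ?_⟩
    · have h1 := h.hv.integrableOn_weakFlux h.hE3 h.hGvm h.hGv h.hGv₂ hGsm hDu (ν := ν)
      rw [hg]
      exact h1.mono_set htT
    · have h1 := h.hv.inner_weakGrad_test_eq h.hE3 h.hu₀ h.hT h.hGvm h.hGv h.hGv₂ hu2 hudiv hGus hDu
        (t := σ) ⟨hσ.1, hσ.2.trans ht.2⟩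
      rw [hQ, hc', hg]
      dsimp only
      rw [integral_inner_comm (u s) (v σ), h1, setIntegral_congr_set Ioo_ae_eq_Ioc]
  -- ### continuity of the boundary data
  have hmemut : MemLp (u t) 2 volume := h.hu.memLp t ⟨ht.1.le, ht.2⟩
  have hmemvt : MemLp (v t) 2 volume := h.hv.memLp t ⟨ht.1.le, ht.2⟩
  have hQ₁c : ContinuousOn (fun σ => Q t σ) (Ioc 0 T) := by
    have h1 := (h.hv.weak_continuous (u t) hmemut).1
    rw [hQ]
    refine h1.congr fun σ _ => ?_
    exact integral_inner_comm (u t) (v σ)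
  have hQ₂c : ContinuousOn (fun s => Q s t) (Ioc 0 T) := by
    have h1 := (h.hu.weak_continuous (v t) hmemvt).1
    rw [hQ]
    exact h1
  have hcc : ContinuousOn c (Ioc 0 T) := by
    have h1 := (h.hv.weak_continuous u₀ h.hu₀).1
    rw [hc]
    refine h1.congr fun σ _ => ?_
    exact integral_inner_comm u₀ (v σ)
  have hc'c : ContinuousOn c' (Ioc 0 T) := by
    have h1 := (h.hu.weak_continuous u₀ h.hu₀).1
    rw [hc']
    refine h1.congr fun s _ => ?_
    exact integral_inner_comm u₀ (u s)
  have hsubIoc : Ioo 0 t ⊆ Ioc 0 T := fun x hx => ⟨hx.1, hx.2.le.trans ht.2⟩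
  have hc0 : Tendsto c (𝓝[>] 0) (𝓝 (∫ x, ⟪u₀ x, u₀ x⟫)) := by
    have h1 := (h.hv.weak_continuous u₀ h.hu₀).2
    rw [hc]
    refine h1.congr fun σ => ?_
    exact integral_inner_comm (v σ) u₀
  have hc'0 : Tendsto c' (𝓝[>] 0) (𝓝 (∫ x, ⟪u₀ x, u₀ x⟫)) := by
    have h1 := (h.hu.weak_continuous u₀ h.hu₀).2
    rw [hc']
    refine h1.congr fun s => ?_
    exact integral_inner_comm (u s) u₀
  have hcb : ∀ σ ∈ Ioo 0 t, |c σ| ≤ K₀ + K₀ := by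
    intro σ hσ
    rw [hc]
    have hσ' : σ ∈ Icc 0 T := ⟨hσ.1.le, hσ.2.le.trans ht.2⟩
    exact (abs_integral_inner_le_kineticEnergy_add h.hu₀ (h.hv.memLp σ hσ')).trans
      (add_le_add le_rfl (hKv σ hσ'))
  have hc'b : ∀ s ∈ Ioo 0 t, |c' s| ≤ K₀ + K₀ := by
    intro s hs
    rw [hc']
    have hs' : s ∈ Icc 0 T := ⟨hs.1.le, hs.2.le.trans ht.2⟩
    exact (abs_integral_inner_le_kineticEnergy_add h.hu₀ (h.hu.memLp s hs')).trans
      (add_le_add le_rfl (hKu s hs'))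
  -- ### integrability of the fluxes on the square
  -- the trilinear parts (through the versions) and the gradient parts
  have hITA : Integrable (fun p : ℝ × ℝ => ∫ x, ⟪Gv p.1 x (u p.2 x), u p.2 x⟫) (νt.prod νt) := by
    have h1 := (h.hu.integrable_sq_tri h.hE3 h.hGum h.hGu h.hGu₂ h.hutm h.hut h.hGvm h.hGv₂).mono_measure hmono2
    refine h1.congr ?_
    filter_upwards [(Measure.quasiMeasurePreserving_snd (μ := νt) (ν := νt)).ae hsu] with p hp
    refine integral_congr_ae ?_
    filter_upwards [hp] with x hx
    rw [hx]
  have hITB : Integrable (fun p : ℝ × ℝ => ∫ x, ⟪Gu p.2 x (v p.1 x), v p.1 x⟫) (νt.prod νt) := by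
    have h1 := ((h.hv.integrable_sq_tri h.hE3 h.hGvm h.hGv h.hGv₂ h.hvtm h.hvt h.hGum h.hGu₂).swap).mono_measure
      hmono2
    refine h1.congr ?_
    filter_upwards [(Measure.quasiMeasurePreserving_fst (μ := νt) (ν := νt)).ae hsv] with p hp
    refine integral_congr_ae ?_
    filter_upwards [hp] with x hx
    simp only [Prod.swap]
    rw [hx]
  have hIΓ : Integrable (fun p : ℝ × ℝ => ∑ i, ∫ x,
      ⟪Gu p.2 x (stdOrthonormalBasis ℝ E i), Gv p.1 x (stdOrthonormalBasis ℝ E i)⟫) (νt.prod νt) := by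
    refine integrable_finsetSum _ fun i _ => ?_
    exact (integrable_sq_grad h.hGum h.hGvm h.hGu₂ h.hGv₂ _
      ((stdOrthonormalBasis ℝ E).orthonormal.1 i)).mono_measure hmono2
  have hIΓ' : Integrable (fun p : ℝ × ℝ => ∑ i, ∫ x,
      ⟪Gv p.1 x (stdOrthonormalBasis ℝ E i), Gu p.2 x (stdOrthonormalBasis ℝ E i)⟫) (νt.prod νt) := by
    refine hIΓ.congr (ae_of_all _ fun p => ?_)
    exact Finset.sum_congr rfl fun i _ => integral_inner_comm _ _
  have hbdd : ∀ n {F : ℝ × ℝ → ℝ}, Integrable F (νt.prod νt) →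
      Integrable (fun p => (φ n).normed volume (p.2 - p.1) * F p) (νt.prod νt) := by
    intro n F hF
    obtain ⟨C, hC0, hC⟩ := FunctionSpaces.exists_normed_le (φ n)
    exact hF.bdd_mul (c := C)
      ((φ n).continuous_normed.comp (continuous_snd.sub continuous_fst)).aestronglyMeasurable
      (ae_of_all _ fun p => by
        rw [Real.norm_eq_abs, abs_of_nonneg ((φ n).nonneg_normed _)]; exact hC _)
  have hfF : ∀ n, Integrable (fun p : ℝ × ℝ => (φ n).normed volume (p.2 - p.1) * f p.1 p.2) (νt.prod νt) := by
    intro n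
    have h1 := hbdd n (hITA.sub (hIΓ.const_mul ν))
    rw [hf]
    exact h1
  have hgF : ∀ n, Integrable (fun p : ℝ × ℝ => (φ n).normed volume (p.2 - p.1) * g p.2 p.1) (νt.prod νt) := by
    intro n
    have h1 := hbdd n (hITB.sub (hIΓ'.const_mul ν))
    rw [hg]
    exact h1
  -- ### the bulk limits
  have hlimA := h.tendsto_triA ht hφ
  have hlimB := h.tendsto_triB ht hφ h'φ
  have hlimΓ := h.tendsto_grad ht hφ
  have hf_lim : Tendsto (fun n => ∫ p, (φ n).normed volume (p.2 - p.1) * f p.1 p.2 ∂(νt.prod νt))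
      atTop (𝓝 (TA - ν * Γ)) := by
    have h1 := hlimA.sub (hlimΓ.const_mul ν)
    refine h1.congr fun n => ?_
    rw [hf]
    dsimp only
    rw [← integral_const_mul, ← integral_sub (hbdd n hITA) ((hbdd n hIΓ).const_mul ν)]
    refine integral_congr_ae (ae_of_all _ fun p => ?_)
    ring
  have hg_lim : Tendsto (fun n => ∫ p, (φ n).normed volume (p.2 - p.1) * g p.2 p.1 ∂(νt.prod νt))
      atTop (𝓝 (-TB - ν * Γ)) := by
    have hlimΓ' : Tendsto (fun n => ∫ p, (φ n).normed volume (p.2 - p.1) * (∑ i, ∫ x,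
        ⟪Gv p.1 x (stdOrthonormalBasis ℝ E i), Gu p.2 x (stdOrthonormalBasis ℝ E i)⟫) ∂(νt.prod νt))
        atTop (𝓝 Γ) := by
      refine hlimΓ.congr fun n => integral_congr_ae (ae_of_all _ fun p => ?_)
      congr 1
      exact Finset.sum_congr rfl fun i _ => integral_inner_comm _ _
    have h1 := hlimB.sub (hlimΓ'.const_mul ν)
    refine h1.congr fun n => ?_
    rw [hg]
    dsimp only
    rw [← integral_const_mul, ← integral_sub (hbdd n hITB) ((hbdd n hIΓ').const_mul ν)]
    refine integral_congr_ae (ae_of_all _ fun p => ?_)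
    ring
  -- ### apply the doubling identity
  have hmain := FunctionSpaces.doubling_identity ht.1 hQm hQb hA hB (hQ₁c.mono hsubIoc)
    (tendsto_nhdsLT_of_continuousOn_Ioc ht.2 ht.1 hQ₁c) (hQ₂c.mono hsubIoc)
    (tendsto_nhdsLT_of_continuousOn_Ioc ht.2 ht.1 hQ₂c) (hcc.mono hsubIoc) hcb hc0
    (hc'c.mono hsubIoc) hc'b hc'0 hφ hfF hgF hf_lim hg_lim
  -- ### rewrite the conclusion
  have hdiag : (∫ s in Ioo 0 t, ((∫ x, ⟪Gv s x (u s x), u s x⟫) - (∫ x, ⟪Gv s x (v s x), u s x⟫)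
      - 2 * ν * ∑ i, ∫ x, ⟪Gu s x (stdOrthonormalBasis ℝ E i), Gv s x (stdOrthonormalBasis ℝ E i)⟫))
      = TA - TB - 2 * ν * Γ := by
    have i1 : IntegrableOn (fun s => ∫ x, ⟪Gv s x (u s x), u s x⟫) (Ioo 0 t) :=
      h.integrableOn_triA_diag.mono_set htT
    have i2 : IntegrableOn (fun s => ∫ x, ⟪Gv s x (v s x), u s x⟫) (Ioo 0 t) :=
      h.integrableOn_triB_diag.mono_set htT
    have i3 : IntegrableOn (fun s => ∑ i, ∫ x,
        ⟪Gu s x (stdOrthonormalBasis ℝ E i), Gv s x (stdOrthonormalBasis ℝ E i)⟫) (Ioo 0 t) :=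
      h.integrableOn_grad_diag.mono_set htT
    have i12 : IntegrableOn (fun s => (∫ x, ⟪Gv s x (u s x), u s x⟫) - ∫ x, ⟪Gv s x (v s x), u s x⟫)
        (Ioo 0 t) := i1.sub i2
    have i3' : IntegrableOn (fun s => 2 * ν * ∑ i, ∫ x,
        ⟪Gu s x (stdOrthonormalBasis ℝ E i), Gv s x (stdOrthonormalBasis ℝ E i)⟫) (Ioo 0 t) :=
      i3.const_mul (2 * ν)
    rw [integral_sub i12 i3', integral_sub i1 i2, integral_const_mul]
  rw [hdiag]
  have hQtt : Q t t = ∫ x, ⟪u t x, v t x⟫ := by rw [hQ]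
  rw [← hQtt, hmain]
  ring

end Cross

/-! ### The difference energy inequality (RRS (8.12)) -/

section Energy

variable {T ν : ℝ} {u₀ : E → E} {u v : ℝ → E → E} {q r : ℝ≥0∞} {Gu Gv : ℝ → E → E →L[ℝ] E}
  {ut vt : ℝ × E → E}

omit [MeasurableSpace E] [BorelSpace E] in
/-- `|A - B|² = |A|² + |B|² - 2 Σᵢ ⟪A eᵢ, B eᵢ⟫` for the Frobenius norm. [folklore] -/
theorem frobeniusNormSq_sub (A B : E →L[ℝ] E) :
    frobeniusNormSq (A - B) = frobeniusNormSq A + frobeniusNormSq B -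
      2 * ∑ i, ⟪A (stdOrthonormalBasis ℝ E i), B (stdOrthonormalBasis ℝ E i)⟫ := by
  simp only [frobeniusNormSq, _root_.sub_apply, norm_sub_sq_real, Finset.sum_add_distrib,
    Finset.sum_sub_distrib, Finset.mul_sum]
  ring

/-- The real dissipation integrand of a good slice is integrable, with integral the (finite)
lower integral. [folklore] -/
theorem integrable_frobeniusNormSq_slice {G : E → E →L[ℝ] E} (hG : AEStronglyMeasurable G volume)
    (hD : ∫⁻ x, ENNReal.ofReal (frobeniusNormSq (G x)) < ⊤) :
    Integrable (fun x => frobeniusNormSq (G x)) volume ∧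
      ∫ x, frobeniusNormSq (G x) = (∫⁻ x, ENNReal.ofReal (frobeniusNormSq (G x))).toReal := by
  have hm : AEStronglyMeasurable (fun x => frobeniusNormSq (G x)) volume :=
    NSWeakStrongUniqueness.continuous_frobeniusNormSq.comp_aestronglyMeasurable hG
  have hi : Integrable (fun x => frobeniusNormSq (G x)) volume := by
    refine ⟨hm, ?_⟩
    have : ∀ x, ‖frobeniusNormSq (G x)‖ₑ = ENNReal.ofReal (frobeniusNormSq (G x)) := fun x =>
      Real.enorm_eq_ofReal (frobeniusNormSq_nonneg _)
    simp only [HasFiniteIntegral, this]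
    exact hD
  exact ⟨hi, integral_eq_lintegral_of_nonneg_ae (ae_of_all _ fun x => frobeniusNormSq_nonneg _) hm⟩

/-- **The difference energy inequality** (Robinson–Rodrigo–Sadowski 2016, (8.12); Serrin 1963,
§4): for the data of the cross-identity argument and every `t ∈ (0,T]`,
`‖w(t)‖² + 2ν∫₀ᵗ‖∇w‖² ≤ 2∫₀ᵗ∫|⟪(w·∇)w, u⟫|`, `w = v - u`, `∇w = Gv - Gu`, in `ℝ≥0∞`.
Proof: add the two energy inequalities, subtract twice the cross identity, use
`|Gv - Gu|² = |Gv|² + |Gu|² - 2Σ⟪Gu eᵢ, Gv eᵢ⟫` and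
`b(u,v,u) - b(v,v,u) = -b(w,w,u)` (the terms `b(v,u,u)`, `b(u,u,u)` vanish by skew-symmetry). [cite: RobinsonRodrigoSadowski2016, (8.12)] -/
theorem CrossData.difference_energy_ineq (h : CrossData E T ν u₀ u v q r Gu Gv ut vt) {t : ℝ}
    (ht : t ∈ Ioc 0 T) :
    eEnergy (v t - u t) + 2 * ENNReal.ofReal ν *
        ∫⁻ τ in Ioo 0 t, ∫⁻ x, ENNReal.ofReal (frobeniusNormSq (Gv τ x - Gu τ x)) ≤
      2 * ∫⁻ τ in Ioo 0 t, ∫⁻ x, ‖⟪(Gv τ x - Gu τ x) (v τ x - u τ x), u τ x⟫‖ₑ := by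
  haveI : ENNReal.HolderTriple 3 6 2 := holderTriple_three_six_two
  set b := stdOrthonormalBasis ℝ E with hb
  have htT : Ioo (0 : ℝ) t ⊆ Ioo 0 T := Ioo_subset_Ioo le_rfl ht.2
  have htI : t ∈ Icc 0 T := ⟨ht.1.le, ht.2⟩
  have hν0 : 0 ≤ ν := h.hν.le
  -- ### the real quantities
  set K₀ : ℝ := VectorCalculus.kineticEnergy u₀ with hK₀
  set TA : ℝ := ∫ s in Ioo 0 t, ∫ x, ⟪Gv s x (u s x), u s x⟫ with hTA
  set TB : ℝ := ∫ s in Ioo 0 t, ∫ x, ⟪Gv s x (v s x), u s x⟫ with hTB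
  set Γ : ℝ := ∫ s in Ioo 0 t, ∑ i, ∫ x, ⟪Gu s x (b i), Gv s x (b i)⟫ with hΓ
  set Lu : ℝ≥0∞ := ∫⁻ τ in Ioo 0 t, ∫⁻ x, ENNReal.ofReal (frobeniusNormSq (Gu τ x)) with hLu
  set Lv : ℝ≥0∞ := ∫⁻ τ in Ioo 0 t, ∫⁻ x, ENNReal.ofReal (frobeniusNormSq (Gv τ x)) with hLv
  set Lw : ℝ≥0∞ := ∫⁻ τ in Ioo 0 t, ∫⁻ x, ENNReal.ofReal (frobeniusNormSq (Gv τ x - Gu τ x)) with hLw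
  have hLu_fin : Lu < ⊤ := lintegral_Ioo_mono_lt_top ht.2 h.hGu₂
  have hLv_fin : Lv < ⊤ := lintegral_Ioo_mono_lt_top ht.2 h.hGv₂
  -- ### cross identity and energy inequalities
  have hCI := h.cross_identity ht
  have hEu := h.hEu t htI
  have hEv := h.hEv t htI
  have hmemu : MemLp (u t) 2 volume := h.hu.memLp t htI
  have hmemv : MemLp (v t) 2 volume := h.hv.memLp t htI
  have hu₀sq : ∫ x, ⟪u₀ x, u₀ x⟫ = 2 * K₀ := by
    rw [hK₀, VectorCalculus.kineticEnergy]
    have : (fun x => ⟪u₀ x, u₀ x⟫) = fun x => ‖u₀ x‖ ^ 2 := by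
      funext x; exact real_inner_self_eq_norm_sq _
    rw [this]; ring
  -- ### `‖w(t)‖² = ‖v‖² - 2⟨u,v⟩ + ‖u‖²`
  have iuv : Integrable (fun x => ⟪u t x, v t x⟫) volume := integrable_inner_of_memLp_two hmemu hmemv
  have iu2 : Integrable (fun x => ‖u t x‖ ^ 2) volume := (memLp_two_iff_integrable_sq_norm hmemu.1).1 hmemu
  have iv2 : Integrable (fun x => ‖v t x‖ ^ 2) volume := (memLp_two_iff_integrable_sq_norm hmemv.1).1 hmemv
  have hwsq : ∫ x, ‖v t x - u t x‖ ^ 2 = 2 * VectorCalculus.kineticEnergy (v t) - 2 * (∫ x, ⟪u t x, v t x⟫) +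
      2 * VectorCalculus.kineticEnergy (u t) := by
    have hpt : (fun x => ‖v t x - u t x‖ ^ 2) = fun x => ‖v t x‖ ^ 2 - 2 * ⟪u t x, v t x⟫ + ‖u t x‖ ^ 2 := by
      funext x; rw [norm_sub_sq_real, real_inner_comm]
    have ia : Integrable (fun x => ‖v t x‖ ^ 2 - 2 * ⟪u t x, v t x⟫) volume := iv2.sub (iuv.const_mul 2)
    rw [hpt, integral_add ia iu2, integral_sub iv2 (iuv.const_mul 2),
      integral_const_mul, VectorCalculus.kineticEnergy, VectorCalculus.kineticEnergy]
    ring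
  -- ### the dissipation of the difference: `Lw = Lu + Lv - 2Γ` (finite)
  have hgu := ae_restrict_Ioo_of_le ht.2 (h.hu.ae_good h.hE3 h.hGum h.hGu h.hGu₂ h.hut)
  have hgv := ae_restrict_Ioo_of_le ht.2 (h.hv.ae_good h.hE3 h.hGvm h.hGv h.hGv₂ h.hvt)
  have hDum : Measurable fun τ => ∫⁻ x, ENNReal.ofReal (frobeniusNormSq (Gu τ x)) :=
    measurable_lintegral_frobeniusNormSq h.hGum
  have hDvm : Measurable fun τ => ∫⁻ x, ENNReal.ofReal (frobeniusNormSq (Gv τ x)) :=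
    measurable_lintegral_frobeniusNormSq h.hGvm
  have hDwm : Measurable fun τ => ∫⁻ x, ENNReal.ofReal (frobeniusNormSq (Gv τ x - Gu τ x)) :=
    measurable_lintegral_frobeniusNormSq (h.hGvm.sub h.hGum)
  -- slice identity for a.e. `τ`
  have hslice : ∀ᵐ τ ∂(volume.restrict (Ioo 0 t)),
      (∫⁻ x, ENNReal.ofReal (frobeniusNormSq (Gv τ x - Gu τ x))).toReal =
        (∫⁻ x, ENNReal.ofReal (frobeniusNormSq (Gu τ x))).toReal +
        (∫⁻ x, ENNReal.ofReal (frobeniusNormSq (Gv τ x))).toReal -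
        2 * ∑ i, ∫ x, ⟪Gu τ x (b i), Gv τ x (b i)⟫ ∧
      ∫⁻ x, ENNReal.ofReal (frobeniusNormSq (Gv τ x - Gu τ x)) < ⊤ := by
    filter_upwards [hgu, hgv] with τ hτu hτv
    obtain ⟨-, -, -, hGuτ, hDu, -, -⟩ := hτu
    obtain ⟨-, -, -, hGvτ, hDv, -, -⟩ := hτv
    have hGum' : AEStronglyMeasurable (Gu τ) volume := hGuτ.aestronglyMeasurable_deriv
    have hGvm' : AEStronglyMeasurable (Gv τ) volume := hGvτ.aestronglyMeasurable_deriv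
    obtain ⟨iU, hU⟩ := integrable_frobeniusNormSq_slice hGum' hDu
    obtain ⟨iV, hV⟩ := integrable_frobeniusNormSq_slice hGvm' hDv
    have hb1 : ∀ i, ‖b i‖ = 1 := fun i => b.orthonormal.1 i
    have iP : ∀ i, Integrable (fun x => ⟪Gu τ x (b i), Gv τ x (b i)⟫) volume := fun i =>
      integrable_inner_of_memLp_two (hGuτ.memLp_apply hDu i) (hGvτ.memLp_apply hDv i)
    have iS : Integrable (fun x => 2 * ∑ i, ⟪Gu τ x (b i), Gv τ x (b i)⟫) volume :=
      (integrable_finsetSum _ fun i _ => iP i).const_mul 2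
    -- integrability and integral of the difference density
    have hpt : (fun x => frobeniusNormSq (Gv τ x - Gu τ x)) = fun x =>
        frobeniusNormSq (Gu τ x) + frobeniusNormSq (Gv τ x) - 2 * ∑ i, ⟪Gu τ x (b i), Gv τ x (b i)⟫ := by
      funext x
      rw [frobeniusNormSq_sub]
      have : ∑ i, ⟪Gv τ x (b i), Gu τ x (b i)⟫ = ∑ i, ⟪Gu τ x (b i), Gv τ x (b i)⟫ :=
        Finset.sum_congr rfl fun i _ => real_inner_comm _ _
      rw [this]; ring
    have iW : Integrable (fun x => frobeniusNormSq (Gv τ x - Gu τ x)) volume := by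
      have iUV : Integrable (fun x => frobeniusNormSq (Gu τ x) + frobeniusNormSq (Gv τ x)) volume := iU.add iV
      rw [hpt]; exact iUV.sub iS
    have hWfin : ∫⁻ x, ENNReal.ofReal (frobeniusNormSq (Gv τ x - Gu τ x)) < ⊤ := by
      have := iW.2
      have heq : ∀ x, ‖frobeniusNormSq (Gv τ x - Gu τ x)‖ₑ = ENNReal.ofReal (frobeniusNormSq (Gv τ x - Gu τ x)) :=
        fun x => Real.enorm_eq_ofReal (frobeniusNormSq_nonneg _)
      simp only [HasFiniteIntegral, heq] at this
      exact this
    refine ⟨?_, hWfin⟩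
    have hW := integral_eq_lintegral_of_nonneg_ae (ae_of_all _ fun x => frobeniusNormSq_nonneg (Gv τ x - Gu τ x))
      iW.1
    have iUV : Integrable (fun x => frobeniusNormSq (Gu τ x) + frobeniusNormSq (Gv τ x)) volume := iU.add iV
    rw [← hW, hpt, integral_sub iUV iS, integral_add iU iV, integral_const_mul,
      integral_finsetSum _ fun i _ => iP i, hU, hV]
  have hLw_fin : Lw < ⊤ := by
    -- `Lw ≤ 2 Lu + 2 Lv`
    have hle : ∀ᵐ τ ∂(volume.restrict (Ioo 0 t)),
        ∫⁻ x, ENNReal.ofReal (frobeniusNormSq (Gv τ x - Gu τ x)) ≤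
          (2 * ∫⁻ x, ENNReal.ofReal (frobeniusNormSq (Gv τ x))) + 2 * ∫⁻ x, ENNReal.ofReal (frobeniusNormSq (Gu τ x)) := by
      filter_upwards [hgu] with τ hτu
      obtain ⟨-, -, -, hGuτ, -, -, -⟩ := hτu
      have hm : AEMeasurable (fun x => ENNReal.ofReal (frobeniusNormSq (Gv τ x))) volume :=
        (ENNReal.measurable_ofReal.comp (NSWeakStrongUniqueness.continuous_frobeniusNormSq.measurable)).comp_aemeasurable
          (h.hGvm.of_uncurry_left (x := τ)).aestronglyMeasurable.aemeasurable
      calc ∫⁻ x, ENNReal.ofReal (frobeniusNormSq (Gv τ x - Gu τ x))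
          ≤ ∫⁻ x, (2 * ENNReal.ofReal (frobeniusNormSq (Gv τ x)) + 2 * ENNReal.ofReal (frobeniusNormSq (Gu τ x))) := by
            refine lintegral_mono fun x => ?_
            have h1 := FluidPDE.frobeniusNormSq_sub_le (Gv τ x) (Gu τ x)
            calc ENNReal.ofReal (frobeniusNormSq (Gv τ x - Gu τ x))
                ≤ ENNReal.ofReal (2 * frobeniusNormSq (Gv τ x) + 2 * frobeniusNormSq (Gu τ x)) :=
                  ENNReal.ofReal_le_ofReal h1
              _ = _ := by
                  rw [ENNReal.ofReal_add (mul_nonneg zero_le_two (frobeniusNormSq_nonneg _))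
                    (mul_nonneg zero_le_two (frobeniusNormSq_nonneg _)), ENNReal.ofReal_mul zero_le_two,
                    ENNReal.ofReal_mul zero_le_two, ENNReal.ofReal_ofNat]
        _ = (2 * ∫⁻ x, ENNReal.ofReal (frobeniusNormSq (Gv τ x))) + 2 * ∫⁻ x, ENNReal.ofReal (frobeniusNormSq (Gu τ x)) := by
            rw [lintegral_add_left' (hm.const_mul _), lintegral_const_mul'' _ hm,
              lintegral_const_mul' _ _ ENNReal.ofNat_ne_top]
    calc Lw ≤ ∫⁻ τ in Ioo 0 t, ((2 * ∫⁻ x, ENNReal.ofReal (frobeniusNormSq (Gv τ x))) +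
        2 * ∫⁻ x, ENNReal.ofReal (frobeniusNormSq (Gu τ x))) := lintegral_mono_ae hle
      _ = 2 * Lv + 2 * Lu := by
          have hm2 : Measurable fun τ => 2 * ∫⁻ x, ENNReal.ofReal (frobeniusNormSq (Gv τ x)) := hDvm.const_mul 2
          rw [lintegral_add_left hm2, lintegral_const_mul 2 hDvm, lintegral_const_mul 2 hDum]
      _ < ⊤ := ENNReal.add_lt_top.2 ⟨ENNReal.mul_lt_top (by simp) hLv_fin, ENNReal.mul_lt_top (by simp) hLu_fin⟩
  have hLw_real : Lw.toReal = Lu.toReal + Lv.toReal - 2 * Γ := by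
    have i1 : Integrable (fun τ => (∫⁻ x, ENNReal.ofReal (frobeniusNormSq (Gu τ x))).toReal) (volume.restrict (Ioo 0 t)) :=
      integrable_toReal_of_lintegral_ne_top hDum.aemeasurable hLu_fin.ne
    have i2 : Integrable (fun τ => (∫⁻ x, ENNReal.ofReal (frobeniusNormSq (Gv τ x))).toReal) (volume.restrict (Ioo 0 t)) :=
      integrable_toReal_of_lintegral_ne_top hDvm.aemeasurable hLv_fin.ne
    have i3 : Integrable (fun τ => 2 * ∑ i, ∫ x, ⟪Gu τ x (b i), Gv τ x (b i)⟫) (volume.restrict (Ioo 0 t)) :=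
      (h.integrableOn_grad_diag.mono_set htT).const_mul 2
    have hw : Lw.toReal = ∫ τ in Ioo 0 t, (∫⁻ x, ENNReal.ofReal (frobeniusNormSq (Gv τ x - Gu τ x))).toReal := by
      rw [integral_toReal hDwm.aemeasurable (hslice.mono fun τ hτ => hτ.2)]
    have hu' : Lu.toReal = ∫ τ in Ioo 0 t, (∫⁻ x, ENNReal.ofReal (frobeniusNormSq (Gu τ x))).toReal := by
      rw [integral_toReal hDum.aemeasurable (ae_lt_top hDum hLu_fin.ne)]
    have hv' : Lv.toReal = ∫ τ in Ioo 0 t, (∫⁻ x, ENNReal.ofReal (frobeniusNormSq (Gv τ x))).toReal := by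
      rw [integral_toReal hDvm.aemeasurable (ae_lt_top hDvm hLv_fin.ne)]
    have i12 : Integrable (fun τ => (∫⁻ x, ENNReal.ofReal (frobeniusNormSq (Gu τ x))).toReal +
        (∫⁻ x, ENNReal.ofReal (frobeniusNormSq (Gv τ x))).toReal) (volume.restrict (Ioo 0 t)) := i1.add i2
    rw [hw, hu', hv', integral_congr_ae (hslice.mono fun τ hτ => hτ.1), integral_sub i12 i3,
      integral_add i1 i2, integral_const_mul]
  -- ### the trilinear difference: `TB - TA = ∫₀ᵗ b(w, w, u)`
  have htri : TB - TA = ∫ τ in Ioo 0 t, ∫ x, ⟪(Gv τ x - Gu τ x) (v τ x - u τ x), u τ x⟫ := by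
    have i1 := h.integrableOn_triA_diag.mono_set htT
    have i2 := h.integrableOn_triB_diag.mono_set htT
    rw [hTB, hTA, ← integral_sub i2 i1]
    refine integral_congr_ae ?_
    haveI : ENNReal.HolderTriple 4 4 2 := holderTriple_four_four_two
    filter_upwards [hgu, hgv] with τ hτu hτv
    obtain ⟨-, hu2, hudiv, hGuτ, hDu, hu4, -⟩ := hτu
    obtain ⟨-, hv2, hvdiv, hGvτ, hDv, hv4, -⟩ := hτv
    have hGum' : AEStronglyMeasurable (Gu τ) volume := hGuτ.aestronglyMeasurable_deriv
    have hGvm' : AEStronglyMeasurable (Gv τ) volume := hGvτ.aestronglyMeasurable_deriv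
    have hmu4 : MemLp (u τ) 4 volume := ⟨hu2.1, hu4⟩
    have hmv4 : MemLp (v τ) 4 volume := ⟨hv2.1, hv4⟩
    -- Lebesgue memberships for the skew-symmetry
    have hu3 : MemLp (u τ) 3 volume := memLp_of_hasWeakGradient h.hE3 hu2 hGuτ hDu (by norm_num) (by norm_num)
    have hu6 : MemLp (u τ) 6 volume := memLp_of_hasWeakGradient h.hE3 hu2 hGuτ hDu (by norm_num) (by norm_num)
    have hv3 : MemLp (v τ) 3 volume := memLp_of_hasWeakGradient h.hE3 hv2 hGvτ hDv (by norm_num) (by norm_num)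
    have h0v : ∫ x, ⟪Gu τ x (v τ x), u τ x⟫ = 0 :=
      integral_inner_weakGrad_apply_self_eq_zero hvdiv hGuτ hDu hu2 (q := 3) (p := 6) (by norm_num) hv3 hu6
    have h0u : ∫ x, ⟪Gu τ x (u τ x), u τ x⟫ = 0 :=
      integral_inner_weakGrad_apply_self_eq_zero hudiv hGuτ hDu hu2 (q := 3) (p := 6) (by norm_num) hu3 hu6
    -- integrability of the four pairings (Hölder `(4,4,2)`)
    have iVv : Integrable (fun x => ⟪Gv τ x (v τ x), u τ x⟫) volume := integrable_inner_apply_of_holder hGvm' hDv hmv4 hmu4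
    have iVu : Integrable (fun x => ⟪Gv τ x (u τ x), u τ x⟫) volume := integrable_inner_apply_of_holder hGvm' hDv hmu4 hmu4
    have iUv : Integrable (fun x => ⟪Gu τ x (v τ x), u τ x⟫) volume := integrable_inner_apply_of_holder hGum' hDu hmv4 hmu4
    have iUu : Integrable (fun x => ⟪Gu τ x (u τ x), u τ x⟫) volume := integrable_inner_apply_of_holder hGum' hDu hmu4 hmu4
    have hpt : (fun x => ⟪(Gv τ x - Gu τ x) (v τ x - u τ x), u τ x⟫) = fun x =>
        (⟪Gv τ x (v τ x), u τ x⟫ - ⟪Gv τ x (u τ x), u τ x⟫) - (⟪Gu τ x (v τ x), u τ x⟫ - ⟪Gu τ x (u τ x), u τ x⟫) := by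
      funext x
      have e1 : (Gv τ x - Gu τ x) (v τ x - u τ x) =
          (Gv τ x (v τ x) - Gv τ x (u τ x)) - (Gu τ x (v τ x) - Gu τ x (u τ x)) := by
        rw [_root_.sub_apply, map_sub, map_sub]
      rw [e1, inner_sub_left, inner_sub_left, inner_sub_left]
    have iA : Integrable (fun x => ⟪Gv τ x (v τ x), u τ x⟫ - ⟪Gv τ x (u τ x), u τ x⟫) volume := iVv.sub iVu
    have iB : Integrable (fun x => ⟪Gu τ x (v τ x), u τ x⟫ - ⟪Gu τ x (u τ x), u τ x⟫) volume := iUv.sub iUu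
    rw [hpt, integral_sub iA iB, integral_sub iVv iVu, integral_sub iUv iUu, h0v, h0u]
    ring
  -- ### the real inequality
  have hsplit : (∫ s in Ioo 0 t, ((∫ x, ⟪Gv s x (u s x), u s x⟫) - (∫ x, ⟪Gv s x (v s x), u s x⟫)
      - 2 * ν * ∑ i, ∫ x, ⟪Gu s x (b i), Gv s x (b i)⟫)) = TA - TB - 2 * ν * Γ := by
    have i1 : IntegrableOn (fun s => ∫ x, ⟪Gv s x (u s x), u s x⟫) (Ioo 0 t) :=
      h.integrableOn_triA_diag.mono_set htT
    have i2 : IntegrableOn (fun s => ∫ x, ⟪Gv s x (v s x), u s x⟫) (Ioo 0 t) :=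
      h.integrableOn_triB_diag.mono_set htT
    have i3 : IntegrableOn (fun s => ∑ i, ∫ x, ⟪Gu s x (b i), Gv s x (b i)⟫) (Ioo 0 t) :=
      h.integrableOn_grad_diag.mono_set htT
    have i12 : IntegrableOn (fun s => (∫ x, ⟪Gv s x (u s x), u s x⟫) - ∫ x, ⟪Gv s x (v s x), u s x⟫)
        (Ioo 0 t) := i1.sub i2
    have i3' : IntegrableOn (fun s => 2 * ν * ∑ i, ∫ x, ⟪Gu s x (b i), Gv s x (b i)⟫) (Ioo 0 t) :=
      i3.const_mul (2 * ν)
    rw [integral_sub i12 i3', integral_sub i1 i2, integral_const_mul]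
  have hreal : (∫ x, ‖v t x - u t x‖ ^ 2) + 2 * ν * Lw.toReal ≤
      2 * ∫ τ in Ioo 0 t, ∫ x, ⟪(Gv τ x - Gu τ x) (v τ x - u τ x), u τ x⟫ := by
    rw [hwsq, hLw_real, ← htri]
    rw [hu₀sq, hsplit] at hCI
    have h1 : ν * Lu.toReal ≤ K₀ - VectorCalculus.kineticEnergy (u t) := by linarith
    have h2 : ν * Lv.toReal ≤ K₀ - VectorCalculus.kineticEnergy (v t) := by linarith
    nlinarith [hCI, h1, h2]
  -- ### conversion to `ℝ≥0∞`
  have hw2 : MemLp (v t - u t) 2 volume := hmemv.sub hmemu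
  have hE1 : eEnergy (v t - u t) = ENNReal.ofReal (∫ x, ‖v t x - u t x‖ ^ 2) := by
    rw [eEnergy_eq_ofReal _ hw2, VectorCalculus.kineticEnergy]
    congr 1
    simp only [Pi.sub_apply]
    ring
  have hE2 : 2 * ENNReal.ofReal ν * Lw = ENNReal.ofReal (2 * ν * Lw.toReal) := by
    rw [ENNReal.ofReal_mul (by positivity), ENNReal.ofReal_mul zero_le_two, ENNReal.ofReal_ofNat,
      ENNReal.ofReal_toReal hLw_fin.ne]
  have hnn1 : 0 ≤ ∫ x, ‖v t x - u t x‖ ^ 2 := integral_nonneg fun x => sq_nonneg _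
  have hnn2 : 0 ≤ 2 * ν * Lw.toReal := by positivity
  rw [hE1, hE2, ← ENNReal.ofReal_add hnn1 hnn2]
  refine (ENNReal.ofReal_le_ofReal hreal).trans ?_
  rw [ENNReal.ofReal_mul zero_le_two, ENNReal.ofReal_ofNat]
  gcongr
  calc ENNReal.ofReal (∫ τ in Ioo 0 t, ∫ x, ⟪(Gv τ x - Gu τ x) (v τ x - u τ x), u τ x⟫)
      ≤ ‖∫ τ in Ioo 0 t, ∫ x, ⟪(Gv τ x - Gu τ x) (v τ x - u τ x), u τ x⟫‖ₑ := Real.ofReal_le_enorm _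
    _ ≤ ∫⁻ τ in Ioo 0 t, ‖∫ x, ⟪(Gv τ x - Gu τ x) (v τ x - u τ x), u τ x⟫‖ₑ :=
        enorm_integral_le_lintegral_enorm _
    _ ≤ ∫⁻ τ in Ioo 0 t, ∫⁻ x, ‖⟪(Gv τ x - Gu τ x) (v τ x - u τ x), u τ x⟫‖ₑ :=
        lintegral_mono fun τ => enorm_integral_le_lintegral_enorm _

end Energy

end Literature.Analysis.FluidPDE

/-! ## The named facts on `ℝ³` and their discharge -/

namespace Literature.Analysis.FluidPDE

open MeasureTheory TopologicalSpace Set Function Filter Topology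
open scoped InnerProductSpace RealInnerProductSpace ENNReal NNReal

/-- **The difference energy inequality with square-integrable datum** (Robinson–Rodrigo–
Sadowski 2016, (8.12); Serrin 1963, §4): the statement of the accepted named fact
`serrin_difference_energy_ineq` under the additional standing hypothesis `u₀ ∈ L²(ℝ³)` of the
sources (RRS Def. 3.3 / Def. 4.9: weak solutions have datum `u₀ ∈ H ⊂ L²`), which the accepted
`Fluid.IsLerayHopfOn` does not record and without which the printed proof (testing with `u₀`,
`⟨u(t),v(t)⟩ → ‖u₀‖²`) is not available. For two Leray–Hopf solutions `u` (Serrin class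
`L^q(0,T;L^r)`, `2/q + 3/r ≤ 1`, `3 < r`) and `v` of the unforced system on `ℝ³ × [0,T)` with the
same datum `u₀ ∈ L²`, and weak-gradient witnesses `Gu`, `Gv` carrying the energy inequalities from
`0`: for every `t ∈ (0,T]`, `‖w(t)‖² + 2ν∫₀ᵗ‖∇w‖² ≤ 2∫₀ᵗ∫|⟪(w·∇)w, u⟫|`, `w = v - u`,
`∇w = Gv - Gu`, in `ℝ≥0∞`. Proved below (`serrin_difference_energy_ineq_memLp_holds`). [cite: RobinsonRodrigoSadowski2016, (8.12)] -/
def serrin_difference_energy_ineq_memLp : Prop :=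
  ∀ {ν T : ℝ} (_hν : 0 < ν) (_hT : 0 < T) {u₀ : EuclideanSpace ℝ (Fin 3) → EuclideanSpace ℝ (Fin 3)}
    {u v : ℝ → EuclideanSpace ℝ (Fin 3) → EuclideanSpace ℝ (Fin 3)}
    (_hu : FluidPDE.IsLerayHopfOn T ν 0 u₀ u) (_hu₀ : MemLp u₀ 2 volume) {q r : ℝ≥0∞} (_hr : 3 < r)
    (_hqr : 2 / q + 3 / r ≤ 1) (_hS : FluidPDE.MemLqLp q r u (Ioo 0 T)) (_hv : FluidPDE.IsLerayHopfOn T ν 0 u₀ v)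
    (Gu Gv : ℝ → EuclideanSpace ℝ (Fin 3) → EuclideanSpace ℝ (Fin 3) →L[ℝ]
      EuclideanSpace ℝ (Fin 3))
    (_hGu : ∀ᵐ t ∂(volume.restrict (Ioo 0 T)), FluidPDE.HasWeakGradient (u t) (Gu t))
    (_hGu₂ : ∫⁻ t in Ioo 0 T, ∫⁻ x, ENNReal.ofReal (FluidPDE.frobeniusNormSq (Gu t x)) < ∞)
    (_hEu : ∀ t ∈ Icc 0 T, VectorCalculus.kineticEnergy (u t) +
      ν * (∫⁻ τ in Ioo 0 t, ∫⁻ x, ENNReal.ofReal (FluidPDE.frobeniusNormSq (Gu τ x))).toReal ≤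
        VectorCalculus.kineticEnergy u₀)
    (_hGv : ∀ᵐ t ∂(volume.restrict (Ioo 0 T)), FluidPDE.HasWeakGradient (v t) (Gv t))
    (_hGv₂ : ∫⁻ t in Ioo 0 T, ∫⁻ x, ENNReal.ofReal (FluidPDE.frobeniusNormSq (Gv t x)) < ∞)
    (_hEv : ∀ t ∈ Icc 0 T, VectorCalculus.kineticEnergy (v t) +
      ν * (∫⁻ τ in Ioo 0 t, ∫⁻ x, ENNReal.ofReal (FluidPDE.frobeniusNormSq (Gv τ x))).toReal ≤
        VectorCalculus.kineticEnergy u₀),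
    ∀ t ∈ Ioc 0 T,
      FluidPDE.eEnergy (v t - u t) +
          2 * ENNReal.ofReal ν *
            ∫⁻ τ in Ioo 0 t, ∫⁻ x, ENNReal.ofReal (FluidPDE.frobeniusNormSq (Gv τ x - Gu τ x)) ≤
        2 * ∫⁻ τ in Ioo 0 t, ∫⁻ x, ‖⟪(Gv τ x - Gu τ x) (v τ x - u τ x), u τ x⟫‖ₑ

/-- **Weak–strong uniqueness in the Ladyzhenskaya–Prodi–Serrin class, with square-integrable
datum** (Prodi 1959; Serrin 1963, Thm. 6; Robinson–Rodrigo–Sadowski 2016, Thm. 8.19): the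
statement of the accepted named fact `NS.weak_strong_uniqueness` (ns.S07) under the additional
standing hypothesis `u₀ ∈ L²(ℝ³)` of the sources (RRS Def. 3.3: a weak solution has datum
`u₀ ∈ H`; Serrin 1963, §1), which `NS.weak_strong_uniqueness` omits — that fact quantifies over
all `u₀ : ℝ³ → ℝ³`, while `Fluid.IsLerayHopfOn` records `u₀` only through Bochner pairings, the
junk-valued `kineticEnergy u₀` and the lower-integral condition `eLpNorm (u t - u₀) 2 → 0`, so
that for non-measurable data the printed argument does not apply. Let `ν > 0`, `u` a Leray–Hopf
weak solution of the unforced system on `ℝ³ × [0,T)` with datum `u₀ ∈ L²` and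
`u ∈ L^q(0,T;L^r)`, `2/q + 3/r ≤ 1`, `3 < r ≤ ∞`; then every Leray–Hopf weak solution `v` on
`[0,T)` with the same viscosity and datum satisfies `v(t) = u(t)` a.e. for every `t ∈ (0,T]`.
Proved below (`serrin_weak_strong_uniqueness_holds`). [cite: Prodi1959] -/
def serrin_weak_strong_uniqueness : Prop :=
  ∀ {ν T : ℝ} (_hν : 0 < ν) (_hT : 0 < T) {u₀ : EuclideanSpace ℝ (Fin 3) → EuclideanSpace ℝ (Fin 3)}
    {u v : ℝ → EuclideanSpace ℝ (Fin 3) → EuclideanSpace ℝ (Fin 3)}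
    (_hu : FluidPDE.IsLerayHopfOn T ν 0 u₀ u) (_hu₀ : MemLp u₀ 2 volume) {q r : ℝ≥0∞} (_hr : 3 < r)
    (_hqr : 2 / q + 3 / r ≤ 1) (_hS : FluidPDE.MemLqLp q r u (Ioo 0 T))
    (_hv : FluidPDE.IsLerayHopfOn T ν 0 u₀ v),
    ∀ t ∈ Ioc 0 T, v t =ᵐ[volume] u t

/-- The accepted fact `weak_strong_uniqueness` (all data) implies the corrected one (datum in
`L²`): the correction only adds a hypothesis. [folklore] -/
theorem serrin_weak_strong_uniqueness_of_weak_strong_uniqueness (h : weak_strong_uniqueness) :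
    serrin_weak_strong_uniqueness := by
  intro ν T hν hT u₀ u v hu _ q r hr hqr hS hv
  exact h hν hT hu hr hqr hS hv

/-- **Discharge of `serrin_difference_energy_ineq_memLp`** (RRS 2016, (8.12); Serrin 1963, §4):
replace the weak-gradient witnesses by jointly measurable versions
(`Fluid.exists_stronglyMeasurable_weakGradient`; all hypotheses and the conclusion only see the
witnesses through slice integrals for a.e. time), take jointly measurable versions of `u, v`,
and apply `Fluid.CrossData.difference_energy_ineq`. [cite: RobinsonRodrigoSadowski2016, (8.12)] -/
theorem serrin_difference_energy_ineq_memLp_holds : serrin_difference_energy_ineq_memLp := by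
  intro ν T hν hT u₀ u v hu hu₀ q r hr hqr hS hv Gu Gv hGu hGu₂ hEu hGv hGv₂ hEv
  have hE3 : Module.finrank ℝ (EuclideanSpace ℝ (Fin 3)) = 3 := finrank_euclideanSpace_fin
  -- measurable witnesses
  obtain ⟨Gu', hGu'm, hGu'ae⟩ := FluidPDE.exists_stronglyMeasurable_weakGradient hu.weak.1 hGu
  obtain ⟨Gv', hGv'm, hGv'ae⟩ := FluidPDE.exists_stronglyMeasurable_weakGradient hv.weak.1 hGv
  have hGu' : ∀ᵐ t ∂(volume.restrict (Ioo 0 T)), FluidPDE.HasWeakGradient (u t) (Gu' t) := by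
    filter_upwards [hGu, hGu'ae] with t h1 h2
    exact h1.congr_grad_ae h2
  have hGv' : ∀ᵐ t ∂(volume.restrict (Ioo 0 T)), FluidPDE.HasWeakGradient (v t) (Gv' t) := by
    filter_upwards [hGv, hGv'ae] with t h1 h2
    exact h1.congr_grad_ae h2
  -- slice dissipations agree a.e.
  have hDu : ∀ᵐ τ ∂(volume.restrict (Ioo 0 T)),
      ∫⁻ x, ENNReal.ofReal (FluidPDE.frobeniusNormSq (Gu' τ x)) = ∫⁻ x, ENNReal.ofReal (FluidPDE.frobeniusNormSq (Gu τ x)) := by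
    filter_upwards [hGu'ae] with τ hτ
    exact lintegral_congr_ae (by filter_upwards [hτ] with x hx; rw [hx])
  have hDv : ∀ᵐ τ ∂(volume.restrict (Ioo 0 T)),
      ∫⁻ x, ENNReal.ofReal (FluidPDE.frobeniusNormSq (Gv' τ x)) = ∫⁻ x, ENNReal.ofReal (FluidPDE.frobeniusNormSq (Gv τ x)) := by
    filter_upwards [hGv'ae] with τ hτ
    exact lintegral_congr_ae (by filter_upwards [hτ] with x hx; rw [hx])
  have hrestr : ∀ {t : ℝ}, t ≤ T → ∀ {P : ℝ → Prop}, (∀ᵐ s ∂(volume.restrict (Ioo 0 T)), P s) →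
      ∀ᵐ s ∂(volume.restrict (Ioo 0 t)), P s := fun ht P hP =>
    ae_restrict_of_ae_restrict_of_subset (Ioo_subset_Ioo le_rfl ht) hP
  have hDu_t : ∀ {t : ℝ}, t ≤ T → ∫⁻ τ in Ioo 0 t, ∫⁻ x, ENNReal.ofReal (FluidPDE.frobeniusNormSq (Gu' τ x)) =
      ∫⁻ τ in Ioo 0 t, ∫⁻ x, ENNReal.ofReal (FluidPDE.frobeniusNormSq (Gu τ x)) := fun ht =>
    lintegral_congr_ae (hrestr ht hDu)
  have hDv_t : ∀ {t : ℝ}, t ≤ T → ∫⁻ τ in Ioo 0 t, ∫⁻ x, ENNReal.ofReal (FluidPDE.frobeniusNormSq (Gv' τ x)) =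
      ∫⁻ τ in Ioo 0 t, ∫⁻ x, ENNReal.ofReal (FluidPDE.frobeniusNormSq (Gv τ x)) := fun ht =>
    lintegral_congr_ae (hrestr ht hDv)
  have hGu₂' : ∫⁻ t in Ioo 0 T, ∫⁻ x, ENNReal.ofReal (FluidPDE.frobeniusNormSq (Gu' t x)) < ∞ := by
    rw [hDu_t le_rfl]; exact hGu₂
  have hGv₂' : ∫⁻ t in Ioo 0 T, ∫⁻ x, ENNReal.ofReal (FluidPDE.frobeniusNormSq (Gv' t x)) < ∞ := by
    rw [hDv_t le_rfl]; exact hGv₂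
  have hEu' : ∀ t ∈ Icc 0 T, VectorCalculus.kineticEnergy (u t) +
      ν * (∫⁻ τ in Ioo 0 t, ∫⁻ x, ENNReal.ofReal (FluidPDE.frobeniusNormSq (Gu' τ x))).toReal ≤
        VectorCalculus.kineticEnergy u₀ := fun t ht => by rw [hDu_t ht.2]; exact hEu t ht
  have hEv' : ∀ t ∈ Icc 0 T, VectorCalculus.kineticEnergy (v t) +
      ν * (∫⁻ τ in Ioo 0 t, ∫⁻ x, ENNReal.ofReal (FluidPDE.frobeniusNormSq (Gv' τ x))).toReal ≤
        VectorCalculus.kineticEnergy u₀ := fun t ht => by rw [hDv_t ht.2]; exact hEv t ht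
  -- jointly measurable versions of `u`, `v`
  have hum := hu.aestronglyMeasurable_uncurry
  have hvm := hv.aestronglyMeasurable_uncurry
  -- the data bundle
  have hData : FluidPDE.CrossData (EuclideanSpace ℝ (Fin 3)) T ν u₀ u v q r Gu' Gv'
      (hum.mk (uncurry u)) (hvm.mk (uncurry v)) :=
    ⟨hE3, hν, hT, hu, hv, hu₀, hr, hqr, hS, hGu'm, hGv'm, hGu', hGv', hGu₂', hGv₂',
      hum.stronglyMeasurable_mk, hvm.stronglyMeasurable_mk, hum.ae_eq_mk, hvm.ae_eq_mk, hEu', hEv'⟩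
  intro t ht
  have hmain := hData.difference_energy_ineq ht
  -- back to the original witnesses
  have hboth : ∀ᵐ τ ∂(volume.restrict (Ioo 0 t)), Gu' τ =ᵐ[volume] Gu τ ∧ Gv' τ =ᵐ[volume] Gv τ := by
    filter_upwards [hrestr ht.2 hGu'ae, hrestr ht.2 hGv'ae] with τ h1 h2
    exact ⟨h1, h2⟩
  have e1 : ∫⁻ τ in Ioo 0 t, ∫⁻ x, ENNReal.ofReal (FluidPDE.frobeniusNormSq (Gv' τ x - Gu' τ x)) =
      ∫⁻ τ in Ioo 0 t, ∫⁻ x, ENNReal.ofReal (FluidPDE.frobeniusNormSq (Gv τ x - Gu τ x)) := by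
    refine lintegral_congr_ae ?_
    filter_upwards [hboth] with τ hτ
    refine lintegral_congr_ae ?_
    filter_upwards [hτ.1, hτ.2] with x hx1 hx2
    rw [hx1, hx2]
  have e2 : ∫⁻ τ in Ioo 0 t, ∫⁻ x, ‖⟪(Gv' τ x - Gu' τ x) (v τ x - u τ x), u τ x⟫‖ₑ =
      ∫⁻ τ in Ioo 0 t, ∫⁻ x, ‖⟪(Gv τ x - Gu τ x) (v τ x - u τ x), u τ x⟫‖ₑ := by
    refine lintegral_congr_ae ?_
    filter_upwards [hboth] with τ hτ
    refine lintegral_congr_ae ?_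
    filter_upwards [hτ.1, hτ.2] with x hx1 hx2
    rw [hx1, hx2]
  rw [e1, e2] at hmain
  exact hmain

/-- **The Sather–Serrin reduction with square-integrable datum** (Robinson–Rodrigo–Sadowski
2016, proof of Thm. 8.19; Serrin 1963, §4): `serrin_weak_strong_uniqueness` follows from the
difference energy inequality `serrin_difference_energy_ineq_memLp`, the trilinear estimate
`serrin_trilinear_estimate` and the time-measurability of dissipation densities
`Fluid.aemeasurable_lintegral_weakGradient`, by the Young–absorption–Gronwall argument of the
accepted `weak_strong_uniqueness_of`, repeated verbatim with the hypothesis `u₀ ∈ L²` threaded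
through. [cite: RobinsonRodrigoSadowski2016, proof of Thm. 8.19] -/
theorem weak_strong_uniqueness_memLp_of
    (h0 : FluidPDE.aemeasurable_lintegral_weakGradient (E := EuclideanSpace ℝ (Fin 3)))
    (h1 : serrin_difference_energy_ineq_memLp) (h2 : serrin_trilinear_estimate) :
    serrin_weak_strong_uniqueness := by
  intro ν T hν hT u₀ u v hu hu₀ q r hr hqr hS hv
  -- ### exponents: `θ = 3/r ∈ [0,1)`, time exponent `ρ = 2/(1-θ) ≤ q`
  have hr0 : r ≠ 0 := by rintro rfl; simp at hr
  have h3r : (3 : ℝ≥0∞) / r < 1 :=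
    (ENNReal.div_lt_iff (Or.inl hr0) (Or.inr (ENNReal.ofNat_ne_top (n := 3)))).2
      (by simpa using hr)
  have h3r_top : (3 : ℝ≥0∞) / r ≠ ∞ := (h3r.trans ENNReal.one_lt_top).ne
  set θ : ℝ := ((3 : ℝ≥0∞) / r).toReal with hθ
  have hθ0 : 0 ≤ θ := ENNReal.toReal_nonneg
  have hθ1 : θ < 1 := by
    have h := (ENNReal.toReal_lt_toReal h3r_top ENNReal.one_ne_top).2 h3r
    rw [ENNReal.toReal_one] at h
    exact h
  set ρ : ℝ := 2 / (1 - θ) with hρ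
  have hρ0 : 0 ≤ ρ := by rw [hρ]; exact div_nonneg zero_le_two (by linarith)
  have hρq : ENNReal.ofReal ρ ≤ q := by
    rcases eq_or_ne q ∞ with rfl | hqtop
    · exact le_top
    have h2q : 2 / q ≤ ENNReal.ofReal (1 - θ) := by
      have := ENNReal.le_sub_of_add_le_right h3r_top hqr
      rwa [← ENNReal.ofReal_toReal h3r_top, ← hθ, ← ENNReal.ofReal_one,
        ← ENNReal.ofReal_sub _ hθ0] at this
    have hq0 : q ≠ 0 := by
      rintro rfl
      rw [ENNReal.div_zero two_ne_zero] at h2q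
      exact absurd h2q (not_le.2 ENNReal.ofReal_lt_top)
    rw [ENNReal.div_le_iff hq0 hqtop] at h2q
    have h2q' : (2 : ℝ) ≤ (1 - θ) * q.toReal := by
      have := ENNReal.toReal_mono (ENNReal.mul_ne_top ENNReal.ofReal_ne_top hqtop) h2q
      rwa [ENNReal.toReal_mul, ENNReal.toReal_ofReal (by linarith), ENNReal.toReal_ofNat] at this
    refine ENNReal.ofReal_le_of_le_toReal ?_
    rw [hρ, div_le_iff₀ (by linarith)]
    linarith
  -- ### the weak-gradient witnesses of `u` and `v`
  obtain ⟨Gu, hGu, hGu₂, hEu', -⟩ := hu.weakGrad_energy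
  obtain ⟨Gv, hGv, hGv₂, hEv', -⟩ := hv.weakGrad_energy
  have hEu : ∀ t ∈ Icc 0 T, VectorCalculus.kineticEnergy (u t) +
      ν * (∫⁻ τ in Ioo 0 t, ∫⁻ x, ENNReal.ofReal (FluidPDE.frobeniusNormSq (Gu τ x))).toReal ≤
        VectorCalculus.kineticEnergy u₀ := fun t ht => by simpa using hEu' t ht
  have hEv : ∀ t ∈ Icc 0 T, VectorCalculus.kineticEnergy (v t) +
      ν * (∫⁻ τ in Ioo 0 t, ∫⁻ x, ENNReal.ofReal (FluidPDE.frobeniusNormSq (Gv τ x))).toReal ≤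
        VectorCalculus.kineticEnergy u₀ := fun t ht => by simpa using hEv' t ht
  -- ### notation
  set w : ℝ → EuclideanSpace ℝ (Fin 3) → EuclideanSpace ℝ (Fin 3) := fun t => v t - u t with hw
  set Gw : ℝ → EuclideanSpace ℝ (Fin 3) → EuclideanSpace ℝ (Fin 3) →L[ℝ]
      EuclideanSpace ℝ (Fin 3) := fun t => Gv t - Gu t with hGw_def
  set Φ : ℝ → ℝ≥0∞ := fun t => FluidPDE.eEnergy (w t) with hΦ
  set Ψ : ℝ → ℝ≥0∞ := fun t => ∫⁻ x, ENNReal.ofReal (FluidPDE.frobeniusNormSq (Gw t x)) with hΨ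
  set Ψu : ℝ → ℝ≥0∞ := fun t => ∫⁻ x, ENNReal.ofReal (FluidPDE.frobeniusNormSq (Gu t x)) with hΨu
  set Ψv : ℝ → ℝ≥0∞ := fun t => ∫⁻ x, ENNReal.ofReal (FluidPDE.frobeniusNormSq (Gv t x)) with hΨv
  set A : ℝ → ℝ≥0∞ := fun t => eLpNorm (u t) r volume ^ ρ with hA
  set L : ℝ → ℝ≥0∞ := fun t => ∫⁻ x, ‖⟪Gw t x (w t x), u t x⟫‖ₑ with hL
  -- ### the difference: slices in `L²`, a.e. weak gradient, measurable dissipation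
  have hwL2 : ∀ t ∈ Icc 0 T, MemLp (w t) 2 volume := fun t ht =>
    (hv.memLp t ht).sub (hu.memLp t ht)
  have hGw : ∀ᵐ t ∂(volume.restrict (Ioo 0 T)), FluidPDE.HasWeakGradient (w t) (Gw t) := by
    filter_upwards [hGu, hGv] with t h₁ h₂
    exact h₂.sub h₁
  have hw_meas : AEStronglyMeasurable (uncurry w) (volume.restrict (Ioo 0 T ×ˢ univ)) := by
    have : uncurry w = uncurry v - uncurry u := rfl
    rw [this]
    exact hv.weak.1.sub hu.weak.1
  have hΨ_meas : AEMeasurable Ψ (volume.restrict (Ioo 0 T)) := h0 hw_meas hGw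
  have hΨu_meas : AEMeasurable Ψu (volume.restrict (Ioo 0 T)) := h0 hu.weak.1 hGu
  have hΨv_meas : AEMeasurable Ψv (volume.restrict (Ioo 0 T)) := h0 hv.weak.1 hGv
  -- `‖∇w‖² ≤ 2‖∇v‖² + 2‖∇u‖²` for a.e. time, hence `∫₀ᵀ ‖∇w‖² < ∞`
  have hΨ_le : ∀ᵐ t ∂(volume.restrict (Ioo 0 T)), Ψ t ≤ 2 * Ψv t + 2 * Ψu t := by
    filter_upwards [hGv] with t hv'
    have hmv : AEMeasurable (fun x => ENNReal.ofReal (FluidPDE.frobeniusNormSq (Gv t x))) volume := by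
      have hli : LocallyIntegrable (Gv t) volume := locallyIntegrableOn_univ.1 (by
        simpa only [Opens.coe_top] using hv'.locallyIntegrableOn_deriv)
      exact ENNReal.measurable_ofReal.comp_aemeasurable
        (NSWeakStrongUniqueness.continuous_frobeniusNormSq.comp_aestronglyMeasurable hli.aestronglyMeasurable).aemeasurable
    calc Ψ t ≤ ∫⁻ x, (2 * ENNReal.ofReal (FluidPDE.frobeniusNormSq (Gv t x)) +
          2 * ENNReal.ofReal (FluidPDE.frobeniusNormSq (Gu t x))) := by
          refine lintegral_mono fun x => ?_
          calc ENNReal.ofReal (FluidPDE.frobeniusNormSq (Gw t x))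
              ≤ ENNReal.ofReal (2 * FluidPDE.frobeniusNormSq (Gv t x) +
                  2 * FluidPDE.frobeniusNormSq (Gu t x)) :=
                ENNReal.ofReal_le_ofReal (frobeniusNormSq_sub_le _ _)
            _ = _ := by
                rw [ENNReal.ofReal_add (by positivity [FluidPDE.frobeniusNormSq_nonneg (Gv t x)])
                  (by positivity [FluidPDE.frobeniusNormSq_nonneg (Gu t x)]),
                  ENNReal.ofReal_mul zero_le_two, ENNReal.ofReal_mul zero_le_two,
                  ENNReal.ofReal_ofNat]
      _ = 2 * Ψv t + 2 * Ψu t := by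
          rw [lintegral_add_left' (hmv.const_mul _), lintegral_const_mul' _ _ ENNReal.ofNat_ne_top,
            lintegral_const_mul' _ _ ENNReal.ofNat_ne_top]
  have hΨT : ∫⁻ t in Ioo 0 T, Ψ t < ∞ := by
    calc ∫⁻ t in Ioo 0 T, Ψ t ≤ ∫⁻ t in Ioo 0 T, (2 * Ψv t + 2 * Ψu t) := lintegral_mono_ae hΨ_le
      _ = (2 * ∫⁻ t in Ioo 0 T, Ψv t) + 2 * ∫⁻ t in Ioo 0 T, Ψu t := by
          rw [lintegral_add_left' (hΨv_meas.const_mul _),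
            lintegral_const_mul' _ _ ENNReal.ofNat_ne_top,
            lintegral_const_mul' _ _ ENNReal.ofNat_ne_top]
      _ < ∞ := ENNReal.add_lt_top.2
          ⟨ENNReal.mul_lt_top ENNReal.ofNat_lt_top hGv₂,
            ENNReal.mul_lt_top ENNReal.ofNat_lt_top hGu₂⟩
  -- ### (8.12): the difference energy inequality
  have H1 := h1 hν hT hu hu₀ hr hqr hS hv Gu Gv hGu hGu₂ hEu hGv hGv₂ hEv
  -- ### the trilinear estimate and Young: pointwise-in-time bound
  obtain ⟨c, hc⟩ := h2 r hr
  obtain ⟨K, hK, hY⟩ := young_absorb hθ0 hθ1 c (ν' := ENNReal.ofReal ν)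
    (by simpa using hν) ENNReal.ofReal_ne_top
  have hLbd : ∀ᵐ τ ∂(volume.restrict (Ioo 0 T)),
      L τ ≤ ENNReal.ofReal ν * Ψ τ + K * (A τ * Φ τ) := by
    filter_upwards [hGw, hS.1, ae_restrict_mem measurableSet_Ioo] with τ hG hSτ hτ
    have := hc (w τ) (u τ) (Gw τ) (hwL2 τ ⟨hτ.1.le, hτ.2.le⟩) hG hSτ
    refine this.trans ?_
    have hy := hY (eLpNorm (u τ) r volume) (Φ τ) (Ψ τ)
    rw [mul_assoc K]  at hy
    simpa only [hA, hρ, mul_assoc] using hy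
  -- ### absorption: `‖w(t)‖² ≤ 2K ∫₀ᵗ ‖u‖_r^ρ ‖w‖²`
  have hmain : ∀ t ∈ Ioc 0 T, Φ t ≤ 2 * K * ∫⁻ τ in Ioo 0 t, A τ * Φ τ := by
    intro t ht
    have hsub : Ioo 0 t ⊆ Ioo 0 T := Ioo_subset_Ioo le_rfl ht.2
    have hΨt_meas : AEMeasurable Ψ (volume.restrict (Ioo 0 t)) :=
      hΨ_meas.mono_measure (Measure.restrict_mono hsub le_rfl)
    set D : ℝ≥0∞ := ∫⁻ τ in Ioo 0 t, Ψ τ with hD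
    have hDtop : D ≠ ∞ := ((lintegral_mono_set hsub).trans_lt hΨT).ne
    have e2 : ∫⁻ τ in Ioo 0 t, L τ ≤ ENNReal.ofReal ν * D + K * ∫⁻ τ in Ioo 0 t, A τ * Φ τ := by
      calc ∫⁻ τ in Ioo 0 t, L τ
          ≤ ∫⁻ τ in Ioo 0 t, (ENNReal.ofReal ν * Ψ τ + K * (A τ * Φ τ)) :=
            lintegral_mono_ae (ae_restrict_of_ae_restrict_of_subset hsub hLbd)
        _ = ENNReal.ofReal ν * D + K * ∫⁻ τ in Ioo 0 t, A τ * Φ τ := by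
            rw [lintegral_add_left' (hΨt_meas.const_mul _),
              lintegral_const_mul' _ _ ENNReal.ofReal_ne_top, lintegral_const_mul' _ _ hK]
    have e1 : Φ t + 2 * ENNReal.ofReal ν * D ≤ 2 * ∫⁻ τ in Ioo 0 t, L τ := H1 t ht
    have e3 : 2 * ENNReal.ofReal ν * D + Φ t ≤
        2 * ENNReal.ofReal ν * D + 2 * K * ∫⁻ τ in Ioo 0 t, A τ * Φ τ := by
      calc 2 * ENNReal.ofReal ν * D + Φ t = Φ t + 2 * ENNReal.ofReal ν * D := add_comm _ _
        _ ≤ 2 * ∫⁻ τ in Ioo 0 t, L τ := e1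
        _ ≤ 2 * (ENNReal.ofReal ν * D + K * ∫⁻ τ in Ioo 0 t, A τ * Φ τ) := by gcongr
        _ = 2 * ENNReal.ofReal ν * D + 2 * K * ∫⁻ τ in Ioo 0 t, A τ * Φ τ := by ring
    exact (ENNReal.add_le_add_iff_left (ENNReal.mul_ne_top
      (ENNReal.mul_ne_top ENNReal.ofNat_ne_top ENNReal.ofReal_ne_top) hDtop)).1 e3
  -- ### boundedness of `‖w(t)‖²` by the energy inequalities
  set M : ℝ≥0∞ := 2 * ENNReal.ofReal (2 * VectorCalculus.kineticEnergy u₀) +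
    2 * ENNReal.ofReal (2 * VectorCalculus.kineticEnergy u₀) with hM
  have hMtop : M ≠ ∞ := ENNReal.add_ne_top.2
    ⟨ENNReal.mul_ne_top ENNReal.ofNat_ne_top ENNReal.ofReal_ne_top,
      ENNReal.mul_ne_top ENNReal.ofNat_ne_top ENNReal.ofReal_ne_top⟩
  have hbound : ∀ t ∈ Ioc 0 T, Φ t ≤ M := by
    intro t ht
    have ht' : t ∈ Icc 0 T := ⟨ht.1.le, ht.2⟩
    have hKEv : FluidPDE.eEnergy (v t) ≤ ENNReal.ofReal (2 * VectorCalculus.kineticEnergy u₀) := by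
      rw [hv.eEnergy_eq ht']
      refine ENNReal.ofReal_le_ofReal (mul_le_mul_of_nonneg_left ?_ zero_le_two)
      exact (le_add_of_nonneg_right (mul_nonneg hν.le ENNReal.toReal_nonneg)).trans (hEv t ht')
    have hKEu : FluidPDE.eEnergy (u t) ≤ ENNReal.ofReal (2 * VectorCalculus.kineticEnergy u₀) := by
      rw [hu.eEnergy_eq ht']
      refine ENNReal.ofReal_le_ofReal (mul_le_mul_of_nonneg_left ?_ zero_le_two)
      exact (le_add_of_nonneg_right (mul_nonneg hν.le ENNReal.toReal_nonneg)).trans (hEu t ht')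
    have hmv : AEMeasurable (fun x => ‖v t x‖ₑ ^ 2) volume :=
      (hv.memLp t ht').aestronglyMeasurable.enorm.pow_const _
    calc Φ t = ∫⁻ x, ‖v t x - u t x‖ₑ ^ 2 := rfl
      _ ≤ ∫⁻ x, (2 * ‖v t x‖ₑ ^ 2 + 2 * ‖u t x‖ₑ ^ 2) := lintegral_mono fun x => enorm_sub_sq_le _ _
      _ = 2 * FluidPDE.eEnergy (v t) + 2 * FluidPDE.eEnergy (u t) := by
          rw [lintegral_add_left' (hmv.const_mul _), lintegral_const_mul' _ _ ENNReal.ofNat_ne_top,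
            lintegral_const_mul' _ _ ENNReal.ofNat_ne_top]
          rfl
      _ ≤ M := by rw [hM]; gcongr
  -- ### integrability of the Gronwall kernel `‖u(t)‖_r^ρ` on `(0, T)`
  have hAT : ∫⁻ t in Ioo 0 T, A t ≠ ∞ := by
    have hvol : volume (Ioo (0 : ℝ) T) ≠ ∞ := by simp
    exact (lintegral_rpow_eLpNorm_lt_top hvol hS hρ0 hρq).ne
  -- ### Gronwall, and conclusion
  intro t ht
  have hΦ0 : Φ t = 0 :=
    lintegral_gronwall_eq_zero (φ := Φ) (a := A) (ENNReal.mul_ne_top ENNReal.ofNat_ne_top hK)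
      hMtop hbound hAT hmain t ht
  have ht' : t ∈ Icc 0 T := ⟨ht.1.le, ht.2⟩
  have hmw : AEMeasurable (fun x => ‖v t x - u t x‖ₑ ^ 2) volume :=
    (hwL2 t ht').aestronglyMeasurable.enorm.pow_const _
  have hae : (fun x => ‖v t x - u t x‖ₑ ^ 2) =ᵐ[volume] 0 := (lintegral_eq_zero_iff' hmw).1 hΦ0
  filter_upwards [hae] with x hx
  simpa [sub_eq_zero] using hx


/-- **Discharge of the corrected weak–strong uniqueness theorem**
`serrin_weak_strong_uniqueness` (Prodi 1959; Serrin 1963, Thm. 6; Robinson–Rodrigo–Sadowski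
2016, Thm. 8.19): the reduction `weak_strong_uniqueness_memLp_of` fed with the three discharged
inputs `Fluid.aemeasurable_lintegral_weakGradient_holds`,
`serrin_difference_energy_ineq_memLp_holds`, `serrin_trilinear_estimate_holds`. [cite: Prodi1959] -/
theorem serrin_weak_strong_uniqueness_holds : serrin_weak_strong_uniqueness :=
  weak_strong_uniqueness_memLp_of FluidPDE.aemeasurable_lintegral_weakGradient_holds
    serrin_difference_energy_ineq_memLp_holds serrin_trilinear_estimate_holds

/-- **What is covered of the accepted `weak_strong_uniqueness` (all data `u₀ : ℝ³ → ℝ³`).**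
The printed theorem (`serrin_weak_strong_uniqueness_holds`) covers exactly the a.e. strongly
measurable data — these are square integrable, `Fluid.IsLerayHopfOn.memLp_two_datum` — and the
Bochner convention covers the data with `x ↦ ‖u₀ x‖²` non-integrable: then `kineticEnergy u₀ = 0`
and the energy inequality from `0` forces `u(t) = v(t) = 0` a.e. for every `t ∈ [0,T]`. The
remaining case of the accepted fact (`u₀` not a.e. strongly measurable with `‖u₀‖²` integrable,
where by `Fluid.IsLerayHopfOn.aestronglyMeasurable_datum_or` both solutions are finite-energy
weak solutions with weak datum `0` not subject to the energy inequality from the datum `0`) is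
not treated in the sources. [cite: Prodi1959] -/
theorem weak_strong_uniqueness_of_datum {ν T : ℝ} (hν : 0 < ν) (hT : 0 < T)
    {u₀ : EuclideanSpace ℝ (Fin 3) → EuclideanSpace ℝ (Fin 3)}
    {u v : ℝ → EuclideanSpace ℝ (Fin 3) → EuclideanSpace ℝ (Fin 3)}
    (hu : FluidPDE.IsLerayHopfOn T ν 0 u₀ u)
    (hdatum : AEStronglyMeasurable u₀ volume ∨ ¬Integrable (fun x => ‖u₀ x‖ ^ 2) volume)
    {q r : ℝ≥0∞} (hr : 3 < r) (hqr : 2 / q + 3 / r ≤ 1) (hS : FluidPDE.MemLqLp q r u (Ioo 0 T))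
    (hv : FluidPDE.IsLerayHopfOn T ν 0 u₀ v) : ∀ t ∈ Ioc 0 T, v t =ᵐ[volume] u t := by
  rcases hdatum with hm | hni
  · exact serrin_weak_strong_uniqueness_holds hν hT hu (hu.memLp_two_datum hT hm) hr hqr hS hv
  · have hK : VectorCalculus.kineticEnergy u₀ = 0 := by
      rw [VectorCalculus.kineticEnergy, integral_undef hni, mul_zero]
    have hzero : ∀ {w : ℝ → EuclideanSpace ℝ (Fin 3) → EuclideanSpace ℝ (Fin 3)},
        FluidPDE.IsLerayHopfOn T ν 0 u₀ w → ∀ t ∈ Ioc 0 T, w t =ᵐ[volume] 0 := by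
      intro w hw t ht
      obtain ⟨G, -, -, hE, -⟩ := hw.weakGrad_energy
      have htI : t ∈ Icc 0 T := ⟨ht.1.le, ht.2⟩
      have hle : VectorCalculus.kineticEnergy (w t) +
          ν * (∫⁻ τ in Ioo 0 t, ∫⁻ x, ENNReal.ofReal (FluidPDE.frobeniusNormSq (G τ x))).toReal ≤ 0 := by
        simpa [hK] using hE t htI
      have hwt : MemLp (w t) 2 volume := hw.memLp t htI
      have hnn : 0 ≤ ν * (∫⁻ τ in Ioo 0 t, ∫⁻ x,
          ENNReal.ofReal (FluidPDE.frobeniusNormSq (G τ x))).toReal := by positivity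
      have hE0 : VectorCalculus.kineticEnergy (w t) = 0 :=
        le_antisymm (by linarith [FluidPDE.kineticEnergy_nonneg (w t)]) (FluidPDE.kineticEnergy_nonneg _)
      have hint : ∫ x, ‖w t x‖ ^ 2 = 0 := by
        have := hE0
        rw [VectorCalculus.kineticEnergy] at this
        simpa using this
      have hsq : (fun x => ‖w t x‖ ^ 2) =ᵐ[volume] 0 :=
        (integral_eq_zero_iff_of_nonneg (fun x => sq_nonneg _)
          ((memLp_two_iff_integrable_sq_norm hwt.1).1 hwt)).1 hint
      filter_upwards [hsq] with x hx
      simpa using hx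
    intro t ht
    exact (hzero hv t ht).trans (hzero hu t ht).symm

end Literature.Analysis.FluidPDE
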